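import Literature.Probability.RandomPlanarGeometry.HexSAWBrickWallStripFugacityWidthOneParityAmplitude
import Literature.Probability.RandomPlanarGeometry.HexSAWBrickWallStripFugacityTwoSidedProp6
import Literature.Analysis.Asymptotics.LinearRecurrenceDominantRoot
import HarnessLib

/-!
# Uniform two-term asymptotics of the two-fugacity one-cell strip:
# `C_{1,N}(y,z) = A_{N mod 2}(y,z)·μ₁(y,z)^N·(1 + O((N+1)Θ^{N/2}))` with EXPLICIT constants, uniformly on compact
# fugacity intervals — and the logarithmic remainder for the variance theorem

Topic `Literature/Probability/RandomPlanarGeometry` (continues `HexSAWBrickWallStripFugacityWidthOneParityAmplitude.lean`: for all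
`y, z > 0` the parity subsequences `C_{1,2M+c}(y,z)/μ₁(y,z)^{2M+c}` of the width-one brick-wall strip `S₁` with wall fugacities `y`
(bottom), `z` (top) converge to explicit amplitudes `A₀, A₁`; `HexSAWBrickWallStripFugacityWidthOneSpectralGap.lean`: every
singularity of the rational series `Σ C_{1,N} x^N = P/(q(x²)(1 − yzx⁴)²)` other than `x = ±1/μ₁` is strictly subdominant).  This file
makes the convergence QUANTITATIVE with constants that are explicit CONTINUOUS functions of the fugacities, and hence UNIFORM on
compact `y`-intervals — the one remaining input («DOOR-ap5-g24 item 1») of the variance theorem `Var_{N,y,z}(bc)/N → ∂b/∂log y`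
via the tree's `Literature.Analysis.tendsto_deriv2_div_of_quasiLinear` (`QuasiLinearSecondDerivative`, hypothesis `hr`).

* §1 `sexticCofactor_ineqs`, ★ `quadRootBound_cofactor_lt`: with `s = μ₁²`, `p = s − y − z`, `κ = yz/s` the explicit root bound
  `R = quadRootBound(p, κ)` of the cofactor `t² + pt + κ` of the sextic cubic satisfies `0 < R < s` — the spectral gap in a form that is
  continuous in `(y, z)` (both branches of the `max`: `√κ < s ⟸ yz < s³`, `(|p| + √(p² − 4κ))/2 < s ⟸ (y + z − s)s² < s³ + yz`).
* §2 (private copies `coeff_rec_six'`, `coeff_rec_eight_yz'` of the tree's private coefficient recurrences), `abs_le_of_rec_eight_sq`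
  (`|e_N| ≤ (N+1)·η^N·Σ_{j<4}(|e_j| + |e_{j+4}|/(yz))/η^j`, `η = (yz)^{1/4}`), ★★ `abs_sub_le_of_decomposition` (THE QUANTITATIVE CORE:
  given any decomposition `d·P = E·q(X²)(1−yzX⁴)² + U·(1−yzX⁴)² + V·q(X²)`, for EVERY `M ≥ 1`
  `|C_{1,2M+c} − A·μ^{2M+c}| ≤ [Γ_c(M+1)R^M s/(s−R)² + (2M+c+1)η^{2M+c}Γ_e]/|d|`, the `U`-part by the landed
  `exists_tendsto_abs_sub_le_of_rec_three` (cubic recurrence, dominant root `s`), the `V`-part by `abs_le_of_rec_two_double_root`,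
  `A` identified by uniqueness of limits).
* §3 `twoTermRate_facts` (`Θ := max(R/s, √(yz)/s) ∈ [0,1)`, `η < μ₁`), ★★ `abs_sub_le_rate_of_decomposition`
  (`|C_{1,2M+c} − Aμ^{2M+c}| ≤ K·(M+1)·Θ^M·μ^{2M+c}`, `K = (Γ_c·s/((s−R)²μ^c) + 2Γ_e)/|d|`).
* §4 the explicit data: `pfE₀, pfE₁, pfU₀…pfU₅, pfV₀…pfV₇` (the sixteen integer polynomials of the tree's partial fractions,
  `kit/pf3.py`), ★ `twoWallP_partialFraction` (`d = ((y−z)² + 2y + 2z + 1)²`; one `ring`, budget line `maxHeartbeats 400000` as in the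
  tree's amplitude file), `continuous_pfCoeffs`, `coeff_poly2/6/8`, (private) `coeff_init_six'`, `coeff_init_eight'`.
* §5 ★★★ `exists_uniform_two_term`: for `z > 0`, `0 < y₁ ≤ y₂` there are `K ≥ 0`, `Θ ∈ [0,1)` with
  `|C_{1,2M+c}(y,z) − A·μ₁(y,z)^{2M+c}| ≤ K·(M+1)·Θ^M·μ₁(y,z)^{2M+c}` for ALL `y ∈ [y₁,y₂]`, `c ∈ {0,1}`, `M ≥ 1` and any parity
  limit `A` (continuity of every constant in `y`: `continuousOn_stripMuY₂`, `ContinuousAt.quadRootBound`, `continuous_pfCoeffs`; `Θ(y) < 1`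
  pointwise; compactness).
* §6 ★★★ `exists_uniform_log_two_term`: with `0 < a₁ ≤ A(y) ≤ a₂` on `[y₁,y₂]` there is `ε` with `M·ε_M → 0` and
  `|log C_{1,2M+c}(y,z) − (2M+c)·log μ₁(y,z) − log A(y)| ≤ ε_M` for ALL `M`, `y ∈ [y₁,y₂]` (small `M`: monotonicity of `C_{1,N}`, `μ₁`
  in `y`; large `M`: `|log x| ≤ 2|x − 1|`).  With `y = y₀e^t` this is the uniform remainder `|F_N − Nφ − G| ≤ ε_N` of the
  quasi-linear free energy `F_N(t) = log C_{1,N}(y₀e^t, z)` along each parity.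

Numerics (`uta_check.py`, exact series + 60-digit constants): the partial-fraction identity holds exactly; on eight fugacity pairs
`(y,z) ∈ {(1,1),(2,1),(½,½),(⅓,3),(5,¼),(7/3,7/3),(0.1,1/7),(9,8)}`: `R/s ∈ [0.10, 0.63]`, `Θ ∈ [0.22, 0.76]`, `K_c ∈ [85, 805]`, and
`max_{M ≤ 60} |C_{2M+c} − A_cμ^{2M+c}| / [K_c(M+1)Θ^Mμ^{2M+c}] ≤ 0.038` (the explicit constant is generous by a factor ≈ 25).

## Sources
R. P. Stanley, *Enumerative Combinatorics* 1 (2nd ed.), §4.1 Theorem 4.1.1 (iii) (coefficients of rational functions are exponential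
polynomials; here with explicit, parameter-continuous remainder); N. R. Beaton, M. Bousquet-Mélou, J. de Gier, H. Duminil-Copin,
A. J. Guttmann, CMP 326 (2014), arXiv:1109.0358v5 §3.2 (p. 10: `C_{T,N}(y,z)`, Proposition 6: `μ_T(y,z)` continuous and monotone;
p. 12: the strip series are rational); N. Madras, G. Slade, *The Self-Avoiding Walk* (1993) §1.1 eq. (1.1.4) p. 5 (the amplitude);
A. Dembo, O. Zeitouni, *Large Deviations Techniques and Applications* (2010) §2.3 (Gärtner–Ellis; the role of the second-order expansion
of the free energy).  Nothing is quoted AS PRINTED: all statements are this lineage's, derived from the tree's series, sextic law and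
parity amplitudes.
-/

noncomputable section

open Filter Topology Finset PowerSeries Literature.Analysis

namespace Literature.Probability.RandomPlanarGeometry.SAW.HexBW

namespace WidthOneYZ

variable {y z : ℝ}

/-! ## §1 The explicit rate: the cofactor's roots are uniformly inside the circle of radius `s` -/

/-- `yz < s³` and `(y + z − s)s² < s³ + yz` (the Schur–Cohn inequalities of the sextic cofactor), `yz < s²`, for `s = μ₁(y,z)²`.
[cite: BeatonBousquetMelouDeGierDuminilCopinGuttmann2014, §3.2 Proposition 6 (arXiv v5 p. 10; the tree's sextic law); Stanley2012EC1, §4.1 Theorem 4.1.1 (iii)] -/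
theorem sexticCofactor_ineqs (hy : 0 < y) (hz : 0 < z) :
    y * z < (stripMuY₂ 1 y z ^ 2) ^ 3 ∧
      (y + z - stripMuY₂ 1 y z ^ 2) * (stripMuY₂ 1 y z ^ 2) ^ 2 < (stripMuY₂ 1 y z ^ 2) ^ 3 + y * z ∧
      y * z < (stripMuY₂ 1 y z ^ 2) ^ 2 := by
  set s := stripMuY₂ 1 y z ^ 2 with hs
  have hμ : 0 < stripMuY₂ 1 y z := stripMuY₂_pos 1 hy hz
  have hs0 : 0 < s := by positivity
  have hsex : s * (s - y) * (s - z) = y * z := stripMuY₂_one_sq_poly_eq hy hz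
  have hmax : max y z < s := max_lt_stripMuY₂_one_sq hy hz
  have hys : y < s := lt_of_le_of_lt (le_max_left _ _) hmax
  have hzs : z < s := lt_of_le_of_lt (le_max_right _ _) hmax
  have hyz : 0 < y * z := mul_pos hy hz
  refine ⟨?_, ?_, ?_⟩
  · nlinarith [mul_pos hs0 hyz, mul_pos (mul_pos hs0 hs0) hy, mul_pos hz (sub_pos.2 hys)]
  · nlinarith [mul_pos hy (mul_pos (sub_pos.2 hzs) (sub_pos.2 hzs)), mul_pos hz (sub_pos.2 (show y * z < s ^ 2 by nlinarith))]
  · nlinarith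

/-- ★ **The explicit root bound is strictly subdominant**: with `s = μ₁(y,z)²`, `p = s − y − z`, `κ = yz/s`,
`0 < R(p, κ) < s` where `R = quadRootBound` bounds the moduli of the roots of the cofactor `t² + pt + κ` of the sextic cubic
`t(t − y)(t − z) − yz = (t − s)(t² + pt + κ)` (the spectral gap, quantitatively and continuously in the fugacities).
[cite: Stanley2012EC1, §4.1 Theorem 4.1.1 (iii); BeatonBousquetMelouDeGierDuminilCopinGuttmann2014, §3.2 Proposition 6 (arXiv v5 p. 10)] -/
theorem quadRootBound_cofactor_lt (hy : 0 < y) (hz : 0 < z) :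
    0 < quadRootBound (stripMuY₂ 1 y z ^ 2 - y - z) (y * z / stripMuY₂ 1 y z ^ 2) ∧
      quadRootBound (stripMuY₂ 1 y z ^ 2 - y - z) (y * z / stripMuY₂ 1 y z ^ 2) < stripMuY₂ 1 y z ^ 2 := by
  set s := stripMuY₂ 1 y z ^ 2 with hs
  have hμ : 0 < stripMuY₂ 1 y z := stripMuY₂_pos 1 hy hz
  have hs0 : 0 < s := by positivity
  obtain ⟨h1, h2, h3⟩ := sexticCofactor_ineqs hy hz
  rw [← hs] at h1 h2 h3
  have hmax : max y z < s := max_lt_stripMuY₂_one_sq hy hz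
  have hys : y < s := lt_of_le_of_lt (le_max_left _ _) hmax
  have hzs : z < s := lt_of_le_of_lt (le_max_right _ _) hmax
  have hyz : 0 < y * z := mul_pos hy hz
  set p := s - y - z with hp
  set κ := y * z / s with hκ
  have hκ0 : 0 < κ := div_pos hyz hs0
  constructor
  · exact lt_of_lt_of_le (Real.sqrt_pos.2 hκ0) (sqrt_le_quadRootBound p κ)
  · -- both branches of the `max` are `< s`
    have hκs : κ < s ^ 2 := by
      rw [hκ, div_lt_iff₀ hs0]; nlinarith
    have hb2 : Real.sqrt κ < s := by
      rw [Real.sqrt_lt' hs0]; exact hκs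
    -- `|p| < s + κ/s`
    have hκ' : κ * s = y * z := by rw [hκ]; field_simp
    have habs : |p| * s < s ^ 2 + κ := by
      rcases le_or_gt 0 p with hp0 | hp0
      · rw [abs_of_nonneg hp0]; nlinarith
      · rw [abs_of_neg hp0]
        -- `(y + z − s)s < s² + yz/s`, i.e. `(y+z−s)s² < s³ + yz`
        have : (y + z - s) * s ^ 2 < s ^ 3 + κ * s := by rw [hκ']; exact h2
        nlinarith
    have h2s : 0 < 2 * s - |p| := by
      have : |p| < 2 * s := by
        rw [abs_lt]; constructor <;> nlinarith
      linarith
    have hb1 : (|p| + Real.sqrt (p ^ 2 - 4 * κ)) / 2 < s := by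
      have hsq : Real.sqrt (p ^ 2 - 4 * κ) < 2 * s - |p| := by
        rw [Real.sqrt_lt' h2s]
        have hpp : |p| ^ 2 = p ^ 2 := sq_abs p
        nlinarith
      linarith
    exact max_lt hb1 hb2

/-! ## §2 The quantitative core: explicit geometric remainder for the parity subsequences -/

/-- If `φ · q(X²) = U` then `[X^{N+6}]φ = (y+z)[X^{N+4}]φ − yz[X^{N+2}]φ + yz[X^N]φ + [X^{N+6}]U` (coefficient recurrence of `U/q(X²)`).
[cite: Stanley2012EC1, §4.1 (Theorem 4.1.1 (i) ⟺ (ii))] -/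
private theorem coeff_rec_six' {φ U : ℝ⟦X⟧}
    (h : φ * ((1 - C y * X ^ 2) * (1 - C z * X ^ 2) - C y * C z * X ^ 6) = U) (N : ℕ) :
    coeff (N + 6) φ = (y + z) * coeff (N + 4) φ - y * z * coeff (N + 2) φ + y * z * coeff N φ + coeff (N + 6) U := by
  have h' : φ = U + C (y + z) * (φ * X ^ 2) - C (y * z) * (φ * X ^ 4) + C (y * z) * (φ * X ^ 6) := by
    simp only [map_add, map_mul]
    linear_combination h
  have e2 : coeff (N + 6) (φ * X ^ 2) = coeff (N + 4) φ := by
    rw [show N + 6 = N + 4 + 2 by ring, PowerSeries.coeff_mul_X_pow]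
  have e4 : coeff (N + 6) (φ * X ^ 4) = coeff (N + 2) φ := by
    rw [show N + 6 = N + 2 + 4 by ring, PowerSeries.coeff_mul_X_pow]
  have e6 : coeff (N + 6) (φ * X ^ 6) = coeff N φ := PowerSeries.coeff_mul_X_pow φ 6 N
  have := congrArg (coeff (N + 6)) h'
  rw [map_add, map_sub, map_add, PowerSeries.coeff_C_mul, PowerSeries.coeff_C_mul, PowerSeries.coeff_C_mul, e2, e4, e6]
    at this
  linear_combination this

/-- If `φ · (1 − yzX⁴)² = V` then `[X^{N+8}]φ = 2yz[X^{N+4}]φ − y²z²[X^N]φ + [X^{N+8}]V`.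
[cite: Stanley2012EC1, §4.1 (Theorem 4.1.1 (i) ⟺ (ii))] -/
private theorem coeff_rec_eight_yz' {φ V : ℝ⟦X⟧} (h : φ * (1 - C y * C z * X ^ 4) ^ 2 = V) (N : ℕ) :
    coeff (N + 8) φ = 2 * (y * z) * coeff (N + 4) φ - (y * z) ^ 2 * coeff N φ + coeff (N + 8) V := by
  have h' : φ = V + C (2 * (y * z)) * (φ * X ^ 4) - C ((y * z) ^ 2) * (φ * X ^ 8) := by
    simp only [map_mul, map_pow, map_ofNat]
    linear_combination h
  have e4 : coeff (N + 8) (φ * X ^ 4) = coeff (N + 4) φ := by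
    rw [show N + 8 = N + 4 + 4 by ring, PowerSeries.coeff_mul_X_pow]
  have e8 : coeff (N + 8) (φ * X ^ 8) = coeff N φ := PowerSeries.coeff_mul_X_pow φ 8 N
  have := congrArg (coeff (N + 8)) h'
  rw [map_sub, map_add, PowerSeries.coeff_C_mul, PowerSeries.coeff_C_mul, e4, e8] at this
  linear_combination this

/-- **The `e`-part is `O(N·(yz)^{N/4})` with explicit constants**: if `e_{N+8} = 2w e_{N+4} − w² e_N` (`w > 0`, `η = w^{1/4}`) then
`|e_N| ≤ (N+1)·η^N·Σ_{j<4} (|e_j| + |e_{j+4}|/w)/η^j` for every `N`.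
[cite: Stanley2012EC1, §4.1 Theorem 4.1.1 (iii) (lane statement, explicit constants)] -/
theorem abs_le_of_rec_eight_sq {w : ℝ} (hw : 0 < w) {e : ℕ → ℝ}
    (he : ∀ N, e (N + 8) = 2 * w * e (N + 4) - w ^ 2 * e N) (N : ℕ) :
    |e N| ≤ ((N : ℝ) + 1) * Real.sqrt (Real.sqrt w) ^ N *
      ∑ j ∈ range 4, (|e j| + |e (j + 4)| / w) / Real.sqrt (Real.sqrt w) ^ j := by
  set η := Real.sqrt (Real.sqrt w) with hη
  have hη0 : 0 < η := Real.sqrt_pos.2 (Real.sqrt_pos.2 hw)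
  have hη4 : η ^ 4 = w := by
    rw [show (4 : ℕ) = 2 * 2 by norm_num, pow_mul, hη, Real.sq_sqrt (Real.sqrt_nonneg _), Real.sq_sqrt hw.le]
  -- residues mod 4
  set j := N % 4 with hj
  set k := N / 4 with hk
  have hN : N = 4 * k + j := by rw [hj, hk]; omega
  have hj4 : j < 4 := by rw [hj]; exact Nat.mod_lt _ (by norm_num)
  set f : ℕ → ℝ := fun i => e (4 * i + j) with hf
  have hfrec : ∀ i, f (i + 2) = 2 * w * f (i + 1) - w ^ 2 * f i := by
    intro i
    simp only [hf]
    rw [show 4 * (i + 2) + j = 4 * i + j + 8 by ring, show 4 * (i + 1) + j = 4 * i + j + 4 by ring, he]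
  have hb := abs_le_of_rec_two_double_root hw hfrec k
  simp only [hf, mul_zero, zero_add, mul_one] at hb
  rw [show 4 * 1 + j = j + 4 by ring] at hb
  rw [← hN] at hb
  -- the `j`-th summand dominates
  have hterm : (|e j| + |e (j + 4)| / w) / η ^ j ≤ ∑ i ∈ range 4, (|e i| + |e (i + 4)| / w) / η ^ i :=
    Finset.single_le_sum (f := fun i => (|e i| + |e (i + 4)| / w) / η ^ i)
      (fun i _ => by positivity) (Finset.mem_range.2 hj4)
  have hk1 : ((k : ℝ) + 1) ≤ (N : ℝ) + 1 := by
    have : k ≤ N := by rw [hN]; omega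
    exact_mod_cast Nat.add_le_add_right this 1
  have hwk : w ^ k = η ^ N / η ^ j := by
    rw [eq_div_iff (pow_ne_zero _ hη0.ne'), ← hη4, ← pow_mul, ← pow_add, hN]
  calc |e N| ≤ ((k : ℝ) + 1) * w ^ k * (|e j| + |e (j + 4)| / w) := hb
    _ = ((k : ℝ) + 1) * η ^ N * ((|e j| + |e (j + 4)| / w) / η ^ j) := by
        rw [hwk]; field_simp
    _ ≤ ((N : ℝ) + 1) * η ^ N * ∑ i ∈ range 4, (|e i| + |e (i + 4)| / w) / η ^ i := by
        gcongr

/-- ★★ **THE QUANTITATIVE CORE — explicit two-term asymptotics along each parity.**  Given a partial-fraction decomposition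
`d·P(X;y,z) = E·q(X²)(1−yzX⁴)² + U·(1−yzX⁴)² + V·q(X²)` of the numerator of the landed series `stripZ₂_one_series`
(`deg E ≤ 1`, `deg U ≤ 5`, `deg V ≤ 7`, `d ≠ 0`; `iq`, `iQ` the inverses of `q(X²)`, `(1−yzX⁴)²`), a parity `c ∈ {0,1}` and the
parity limit `A = lim C_{1,2M+c}/μ^{2M+c}` (tree: `tendsto_stripZ₂_one_even/odd_div_pow`), for EVERY `M ≥ 1`:
`|C_{1,2M+c}(y,z) − A·μ₁(y,z)^{2M+c}| ≤ [Γ_c·(M+1)·R^M·s/(s−R)² + (2M+c+1)·η^{2M+c}·Γ_e] / |d|`, where `s = μ₁²`,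
`R = quadRootBound(s − y − z, yz/s) < s` (§1), `η = (yz)^{1/4} < μ₁`, `Γ_c = |u_{c+2} − s u_c| + |u_{c+4} − s u_{c+2}|/R`,
`Γ_e = Σ_{j<4} (|e_j| + |e_{j+4}|/(yz))/η^j`, `u_k = [X^k] U·iq`, `e_k = [X^k] V·iQ` — all constants explicit and continuous in the data.
(The `U/q(X²)` parity subsequence obeys the cubic recurrence with characteristic polynomial `(t − s)(t² + (s−y−z)t + yz/s)`:
`exists_tendsto_abs_sub_le_of_rec_three`; the `V`-part: `abs_le_of_rec_eight_sq`; `A` is identified by uniqueness of limits.)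
[cite: Stanley2012EC1, §4.1 Theorem 4.1.1 (iii) (lane statement with explicit constants); BeatonBousquetMelouDeGierDuminilCopinGuttmann2014, §3.2 (arXiv v5 p. 10: C_{T,N}(y,z); Proposition 6: μ_T(y,z); p. 12: the strip series are rational); MadrasSlade1993, §1.1 eq. (1.1.4) p. 5 (the amplitude)] -/
theorem abs_sub_le_of_decomposition (hy : 0 < y) (hz : 0 < z) {E U V iq iQ : ℝ⟦X⟧} {d : ℝ} (hd : d ≠ 0)
    (hPF : C d * twoWallP y z = E * (((1 - C y * X ^ 2) * (1 - C z * X ^ 2) - C y * C z * X ^ 6)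
      * (1 - C y * C z * X ^ 4) ^ 2) + U * (1 - C y * C z * X ^ 4) ^ 2
      + V * ((1 - C y * X ^ 2) * (1 - C z * X ^ 2) - C y * C z * X ^ 6))
    (hE : ∀ N, coeff (N + 2) E = 0) (hU : ∀ N, coeff (N + 6) U = 0) (hV : ∀ N, coeff (N + 8) V = 0)
    (hqinv : ((1 - C y * X ^ 2) * (1 - C z * X ^ 2) - C y * C z * X ^ 6) * iq = 1)
    (hQinv : (1 - C y * C z * X ^ 4) ^ 2 * iQ = 1)
    {c : ℕ} {A : ℝ}
    (hA : Tendsto (fun M => stripZ₂ 1 (2 * M + c) y z / stripMuY₂ 1 y z ^ (2 * M + c)) atTop (𝓝 A))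
    {M : ℕ} (hM : 1 ≤ M) :
    |stripZ₂ 1 (2 * M + c) y z - A * stripMuY₂ 1 y z ^ (2 * M + c)| ≤
      ((|coeff (c + 2) (U * iq) - stripMuY₂ 1 y z ^ 2 * coeff c (U * iq)|
          + |coeff (c + 4) (U * iq) - stripMuY₂ 1 y z ^ 2 * coeff (c + 2) (U * iq)|
            / quadRootBound (stripMuY₂ 1 y z ^ 2 - y - z) (y * z / stripMuY₂ 1 y z ^ 2))
        * ((M : ℝ) + 1) * quadRootBound (stripMuY₂ 1 y z ^ 2 - y - z) (y * z / stripMuY₂ 1 y z ^ 2) ^ M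
        * (stripMuY₂ 1 y z ^ 2 /
            (stripMuY₂ 1 y z ^ 2 - quadRootBound (stripMuY₂ 1 y z ^ 2 - y - z) (y * z / stripMuY₂ 1 y z ^ 2)) ^ 2)
       + (((2 * M + c : ℕ) : ℝ) + 1) * Real.sqrt (Real.sqrt (y * z)) ^ (2 * M + c)
          * ∑ j ∈ range 4, (|coeff j (V * iQ)| + |coeff (j + 4) (V * iQ)| / (y * z)) / Real.sqrt (Real.sqrt (y * z)) ^ j)
      / |d| := by
  set μ := stripMuY₂ 1 y z with hμdef
  have hμ : 0 < μ := stripMuY₂_pos 1 hy hz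
  have hμ0 : μ ≠ 0 := hμ.ne'
  obtain ⟨hR0, hRs⟩ := quadRootBound_cofactor_lt hy hz
  rw [← hμdef] at hR0 hRs
  set s := μ ^ 2 with hsdef
  have hs : 0 < s := by positivity
  have hsex : s * (s - y) * (s - z) = y * z := stripMuY₂_one_sq_poly_eq hy hz
  set R := quadRootBound (s - y - z) (y * z / s) with hRdef
  have hyz : 0 < y * z := mul_pos hy hz
  -- the series identity and the coefficient extraction (as in the tree's core)
  set Aser : ℝ⟦X⟧ := PowerSeries.mk (fun N => stripZ₂ 1 N y z) with hAser
  set qX : ℝ⟦X⟧ := (1 - C y * X ^ 2) * (1 - C z * X ^ 2) - C y * C z * X ^ 6 with hqX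
  set Q2 : ℝ⟦X⟧ := (1 - C y * C z * X ^ 4) ^ 2 with hQ2
  have hS : Aser * (qX * Q2) = twoWallP y z := stripZ₂_one_series y z
  have hdec : C d * Aser = E + U * iq + V * iQ := by
    linear_combination (-(C d) * Aser * Q2 * iQ + E * Q2 * iQ + V * iQ) * hqinv + (-(C d) * Aser + E + U * iq) * hQinv
      + (C d * iq * iQ) * hS + (iq * iQ) * hPF
  set u : ℕ → ℝ := fun N => coeff N (U * iq) with hu
  set e : ℕ → ℝ := fun N => coeff N (V * iQ) with he
  have hUiq : U * iq * ((1 - C y * X ^ 2) * (1 - C z * X ^ 2) - C y * C z * X ^ 6) = U := by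
    rw [← hqX, mul_assoc, mul_comm iq qX, hqinv, mul_one]
  have hurec : ∀ N, u (N + 6) = (y + z) * u (N + 4) - y * z * u (N + 2) + y * z * u N := by
    intro N; have := coeff_rec_six' hUiq N; rw [hU N, add_zero] at this; exact this
  have hViQ : V * iQ * (1 - C y * C z * X ^ 4) ^ 2 = V := by
    rw [← hQ2, mul_assoc, mul_comm iQ Q2, hQinv, mul_one]
  have herec : ∀ N, e (N + 8) = 2 * (y * z) * e (N + 4) - (y * z) ^ 2 * e N := by
    intro N; have := coeff_rec_eight_yz' hViQ N; rw [hV N, add_zero] at this; exact this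
  have hcoef : ∀ N, d * stripZ₂ 1 (N + 2) y z = u (N + 2) + e (N + 2) := by
    intro N
    have := congrArg (coeff (N + 2)) hdec
    simp only [hAser, map_add, PowerSeries.coeff_C_mul, coeff_mk, hE N, zero_add] at this
    simpa only [hu, he] using this
  -- the parity subsequence obeys the cubic recurrence
  set b : ℕ → ℝ := fun M => u (2 * M + c) with hb
  have hbrec : ∀ M, b (M + 3) = (y + z) * b (M + 2) + -(y * z) * b (M + 1) + y * z * b M := by
    intro M
    simp only [hb]
    rw [show 2 * (M + 3) + c = 2 * M + c + 6 by ring, show 2 * (M + 2) + c = 2 * M + c + 4 by ring,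
      show 2 * (M + 1) + c = 2 * M + c + 2 by ring, hurec]
    ring
  set p := s - y - z with hp
  set κ := y * z / s with hκ
  have hAc : y + z = s - p := by rw [hp]; ring
  have hκs : κ * s = y * z := by rw [hκ]; field_simp
  have hBc : -(y * z) = p * s - κ := by
    have : p * s - κ = -(y * z) := by
      have e1 : p * s * s = (s - y - z) * s ^ 2 := by rw [hp]; ring
      -- `s²(s − y − z) = yz − yz·s` by the sextic law; divide by `s`
      have e2 : (s - y - z) * s ^ 2 = y * z - y * z * s := by linear_combination hsex
      have e3 : (p * s - κ) * s = -(y * z) * s := by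
        have := hκs
        nlinarith [e1, e2, this]
      exact mul_right_cancel₀ hs.ne' e3
    rw [this]
  have hCc : y * z = κ * s := hκs.symm
  have hroot : ∀ σ : ℂ, σ ^ 2 + (p : ℂ) * σ + (κ : ℂ) = 0 → ‖σ‖ ≤ R := fun σ hσ => norm_le_quadRootBound hσ
  obtain ⟨L, hL, hbnd⟩ := exists_tendsto_abs_sub_le_of_rec_three hs hR0 hRs hAc hBc hCc hroot b hbrec
  -- the `e`-part
  have hyzs : y * z < μ ^ 4 := by
    have h3 := (sexticCofactor_ineqs hy hz).2.2
    rw [← hμdef] at h3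
    have : μ ^ 4 = s ^ 2 := by rw [hsdef]; ring
    rw [this]; exact h3
  have helim := tendsto_div_pow_zero_of_rec_eight_sq hyz hμ hyzs herec
  -- identify `A = L/(d μ^c)` by uniqueness of limits
  have hd' : (d : ℝ) * μ ^ c ≠ 0 := mul_ne_zero hd (pow_ne_zero _ hμ0)
  have helim' : Tendsto (fun M => e (2 * M + c) / μ ^ (2 * M + c)) atTop (𝓝 0) :=
    helim.comp (tendsto_atTop_atTop.2 fun B => ⟨B, fun M hM => by omega⟩ :
      Tendsto (fun M => 2 * M + c) atTop atTop)
  have hlim : Tendsto (fun M => (b M / s ^ M) / (d * μ ^ c) + (e (2 * M + c) / μ ^ (2 * M + c)) / d) atTop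
      (𝓝 (L / (d * μ ^ c) + 0 / d)) :=
    (hL.div_const _).add (helim'.div_const _)
  rw [zero_div, add_zero] at hlim
  have key : Tendsto (fun M => stripZ₂ 1 (2 * (M + 1) + c) y z / μ ^ (2 * (M + 1) + c)) atTop
      (𝓝 (L / (d * μ ^ c))) := by
    refine (hlim.comp (tendsto_add_atTop_nat 1)).congr fun M => ?_
    simp only [Function.comp_apply, hb]
    have hN : 2 * (M + 1) + c = 2 * M + c + 2 := by ring
    have hZ : stripZ₂ 1 (2 * M + c + 2) y z = (u (2 * M + c + 2) + e (2 * M + c + 2)) / d := by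
      rw [eq_div_iff hd, mul_comm]; exact hcoef _
    have hμpow : μ ^ (2 * M + c + 2) = s ^ (M + 1) * μ ^ c := by
      rw [hsdef, ← pow_mul, ← pow_add]; ring_nf
    rw [hN, hZ, hμpow]
    field_simp
  have key' := (tendsto_add_atTop_iff_nat (f := fun M => stripZ₂ 1 (2 * M + c) y z / μ ^ (2 * M + c)) 1).1 key
  have hAL : A = L / (d * μ ^ c) := tendsto_nhds_unique hA key'
  -- the bound at `M ≥ 1`
  obtain ⟨M', rfl⟩ : ∃ M', M = M' + 1 := ⟨M - 1, by omega⟩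
  have hN : 2 * (M' + 1) + c = 2 * M' + c + 2 := by ring
  have hZ : stripZ₂ 1 (2 * M' + c + 2) y z = (b (M' + 1) + e (2 * M' + c + 2)) / d := by
    rw [eq_div_iff hd, mul_comm]
    simp only [hb]
    rw [show 2 * (M' + 1) + c = 2 * M' + c + 2 by ring]
    exact hcoef _
  have hμpow : μ ^ (2 * M' + c + 2) = s ^ (M' + 1) * μ ^ c := by
    rw [hsdef, ← pow_mul, ← pow_add]; ring_nf
  have hdiff : stripZ₂ 1 (2 * (M' + 1) + c) y z - A * μ ^ (2 * (M' + 1) + c)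
      = ((b (M' + 1) - L * s ^ (M' + 1)) + e (2 * M' + c + 2)) / d := by
    rw [hN, hZ, hμpow, hAL]
    field_simp
    ring
  rw [hdiff, abs_div]
  apply div_le_div_of_nonneg_right _ (abs_nonneg d)
  have h1 := hbnd (M' + 1)
  have h2 := abs_le_of_rec_eight_sq hyz herec (2 * M' + c + 2)
  -- initial data of `b`
  have hb0 : b 0 = coeff c (U * iq) := by simp only [hb, hu, mul_zero, zero_add]
  have hb1 : b 1 = coeff (c + 2) (U * iq) := by simp only [hb, hu, mul_one, add_comm]
  have hb2 : b 2 = coeff (c + 4) (U * iq) := by simp only [hb, hu, show 2 * 2 + c = c + 4 by ring]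
  rw [hb0, hb1, hb2] at h1
  rw [← hN] at h2 ⊢
  push_cast at h1 h2 ⊢
  calc |b (M' + 1) - L * s ^ (M' + 1) + e (2 * (M' + 1) + c)|
      ≤ |b (M' + 1) - L * s ^ (M' + 1)| + |e (2 * (M' + 1) + c)| := abs_add_le _ _
    _ ≤ _ := add_le_add h1 h2

/-! ## §3 The rate form: `|C_{1,2M+c} − Aμ^{2M+c}| ≤ K·(M+1)·Θ^M·μ^{2M+c}` with `Θ = max(R/s, √(yz)/s) < 1` -/

/-- `Θ(y,z) = max(R/s, √(yz)/s) ∈ [0, 1)` and `(yz)^{1/4} < μ₁(y,z)`, `s = μ₁²`, `R = quadRootBound(s − y − z, yz/s)`.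
[cite: Stanley2012EC1, §4.1 Theorem 4.1.1 (iii); BeatonBousquetMelouDeGierDuminilCopinGuttmann2014, §3.2 Proposition 6 (arXiv v5 p. 10)] -/
theorem twoTermRate_facts (hy : 0 < y) (hz : 0 < z) :
    0 ≤ max (quadRootBound (stripMuY₂ 1 y z ^ 2 - y - z) (y * z / stripMuY₂ 1 y z ^ 2) / stripMuY₂ 1 y z ^ 2)
        (Real.sqrt (y * z) / stripMuY₂ 1 y z ^ 2) ∧
      max (quadRootBound (stripMuY₂ 1 y z ^ 2 - y - z) (y * z / stripMuY₂ 1 y z ^ 2) / stripMuY₂ 1 y z ^ 2)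
        (Real.sqrt (y * z) / stripMuY₂ 1 y z ^ 2) < 1 ∧
      Real.sqrt (Real.sqrt (y * z)) < stripMuY₂ 1 y z := by
  set μ := stripMuY₂ 1 y z with hμdef
  have hμ : 0 < μ := stripMuY₂_pos 1 hy hz
  obtain ⟨hR0, hRs⟩ := quadRootBound_cofactor_lt hy hz
  obtain ⟨-, -, h3⟩ := sexticCofactor_ineqs hy hz
  rw [← hμdef] at hR0 hRs h3
  set s := μ ^ 2 with hsdef
  have hs : 0 < s := by positivity
  have hyz : 0 < y * z := mul_pos hy hz
  have hsq : Real.sqrt (y * z) < s := by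
    rw [Real.sqrt_lt' hs]; exact h3
  have hη : Real.sqrt (Real.sqrt (y * z)) < μ := by
    rw [Real.sqrt_lt' hμ, ← hsdef]; exact hsq
  refine ⟨le_max_of_le_left (div_nonneg hR0.le hs.le), max_lt ?_ ?_, hη⟩
  · rwa [div_lt_one hs]
  · rwa [div_lt_one hs]

/-- ★★ **Rate form of the quantitative core**: under the hypotheses of `abs_sub_le_of_decomposition`, for every `M ≥ 1`,
`|C_{1,2M+c}(y,z) − A μ^{2M+c}| ≤ K·(M+1)·Θ^M·μ^{2M+c}` with `Θ = max(R/s, √(yz)/s) < 1` and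
`K = (Γ_c·s/((s−R)²μ^c) + 2Γ_e)/|d|` (`Γ_c, Γ_e` the explicit initial-data constants of the core).
[cite: Stanley2012EC1, §4.1 Theorem 4.1.1 (iii) (lane statement with explicit constants); BeatonBousquetMelouDeGierDuminilCopinGuttmann2014, §3.2 (arXiv v5 pp. 10, 12)] -/
theorem abs_sub_le_rate_of_decomposition (hy : 0 < y) (hz : 0 < z) {E U V iq iQ : ℝ⟦X⟧} {d : ℝ} (hd : d ≠ 0)
    (hPF : C d * twoWallP y z = E * (((1 - C y * X ^ 2) * (1 - C z * X ^ 2) - C y * C z * X ^ 6)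
      * (1 - C y * C z * X ^ 4) ^ 2) + U * (1 - C y * C z * X ^ 4) ^ 2
      + V * ((1 - C y * X ^ 2) * (1 - C z * X ^ 2) - C y * C z * X ^ 6))
    (hE : ∀ N, coeff (N + 2) E = 0) (hU : ∀ N, coeff (N + 6) U = 0) (hV : ∀ N, coeff (N + 8) V = 0)
    (hqinv : ((1 - C y * X ^ 2) * (1 - C z * X ^ 2) - C y * C z * X ^ 6) * iq = 1)
    (hQinv : (1 - C y * C z * X ^ 4) ^ 2 * iQ = 1)
    {c : ℕ} (hc : c < 2) {A : ℝ}
    (hA : Tendsto (fun M => stripZ₂ 1 (2 * M + c) y z / stripMuY₂ 1 y z ^ (2 * M + c)) atTop (𝓝 A))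
    {M : ℕ} (hM : 1 ≤ M) :
    |stripZ₂ 1 (2 * M + c) y z - A * stripMuY₂ 1 y z ^ (2 * M + c)| ≤
      ((|coeff (c + 2) (U * iq) - stripMuY₂ 1 y z ^ 2 * coeff c (U * iq)|
            + |coeff (c + 4) (U * iq) - stripMuY₂ 1 y z ^ 2 * coeff (c + 2) (U * iq)|
              / quadRootBound (stripMuY₂ 1 y z ^ 2 - y - z) (y * z / stripMuY₂ 1 y z ^ 2))
          * (stripMuY₂ 1 y z ^ 2 /
            ((stripMuY₂ 1 y z ^ 2 - quadRootBound (stripMuY₂ 1 y z ^ 2 - y - z) (y * z / stripMuY₂ 1 y z ^ 2)) ^ 2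
              * stripMuY₂ 1 y z ^ c))
        + 2 * ∑ j ∈ range 4,
            (|coeff j (V * iQ)| + |coeff (j + 4) (V * iQ)| / (y * z)) / Real.sqrt (Real.sqrt (y * z)) ^ j)
      / |d| * ((M : ℝ) + 1)
      * max (quadRootBound (stripMuY₂ 1 y z ^ 2 - y - z) (y * z / stripMuY₂ 1 y z ^ 2) / stripMuY₂ 1 y z ^ 2)
          (Real.sqrt (y * z) / stripMuY₂ 1 y z ^ 2) ^ M
      * stripMuY₂ 1 y z ^ (2 * M + c) := by
  have h := abs_sub_le_of_decomposition hy hz hd hPF hE hU hV hqinv hQinv hA hM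
  set μ := stripMuY₂ 1 y z with hμdef
  have hμ : 0 < μ := stripMuY₂_pos 1 hy hz
  obtain ⟨hR0, hRs⟩ := quadRootBound_cofactor_lt hy hz
  obtain ⟨hΘ0, hΘ1, hη⟩ := twoTermRate_facts hy hz
  rw [← hμdef] at hR0 hRs hΘ0 hΘ1 hη
  set s := μ ^ 2 with hsdef
  have hs : 0 < s := by positivity
  have hyz : 0 < y * z := mul_pos hy hz
  set R := quadRootBound (s - y - z) (y * z / s) with hRdef
  set Θ := max (R / s) (Real.sqrt (y * z) / s) with hΘdef
  set η := Real.sqrt (Real.sqrt (y * z)) with hηdef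
  have hη0 : 0 ≤ η := Real.sqrt_nonneg _
  have hη2 : η ^ 2 = Real.sqrt (y * z) := by rw [hηdef, Real.sq_sqrt (Real.sqrt_nonneg _)]
  set Γc := |coeff (c + 2) (U * iq) - s * coeff c (U * iq)| + |coeff (c + 4) (U * iq) - s * coeff (c + 2) (U * iq)| / R
    with hΓc
  set Γe := ∑ j ∈ range 4, (|coeff j (V * iQ)| + |coeff (j + 4) (V * iQ)| / (y * z)) / η ^ j with hΓe
  have hΓc0 : 0 ≤ Γc := by positivity
  have hΓe0 : 0 ≤ Γe := Finset.sum_nonneg fun j _ => by positivity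
  have hsR : 0 < s - R := sub_pos.2 hRs
  have hM0 : (0 : ℝ) ≤ M := M.cast_nonneg
  -- `μ^{2M+c} = s^M μ^c`
  have hμpow : μ ^ (2 * M + c) = s ^ M * μ ^ c := by rw [hsdef, ← pow_mul, pow_add]
  -- the `b`-term
  have hRs' : R / s ≤ Θ := le_max_left _ _
  have hRsM : (R / s) ^ M ≤ Θ ^ M := pow_le_pow_left₀ (div_nonneg hR0.le hs.le) hRs' M
  have hb : Γc * ((M : ℝ) + 1) * R ^ M * (s / (s - R) ^ 2)
      ≤ Γc * (s / ((s - R) ^ 2 * μ ^ c)) * ((M : ℝ) + 1) * Θ ^ M * μ ^ (2 * M + c) := by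
    have e : Γc * ((M : ℝ) + 1) * R ^ M * (s / (s - R) ^ 2)
        = Γc * (s / ((s - R) ^ 2 * μ ^ c)) * ((M : ℝ) + 1) * (R / s) ^ M * μ ^ (2 * M + c) := by
      rw [hμpow, div_pow]
      field_simp
    rw [e]
    have hK : 0 ≤ Γc * (s / ((s - R) ^ 2 * μ ^ c)) * ((M : ℝ) + 1) := by positivity
    have := mul_le_mul_of_nonneg_left hRsM hK
    exact mul_le_mul_of_nonneg_right this (pow_pos hμ _).le
  -- the `e`-term
  have hηs : η ^ 2 / s ≤ Θ := by rw [hη2]; exact le_max_right _ _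
  have hηsM : (η ^ 2 / s) ^ M ≤ Θ ^ M := pow_le_pow_left₀ (by positivity) hηs M
  have hηc : η ^ c ≤ μ ^ c := pow_le_pow_left₀ hη0 hη.le c
  have hN1 : (((2 * M + c : ℕ) : ℝ) + 1) ≤ 2 * ((M : ℝ) + 1) := by
    have : c ≤ 1 := by omega
    have hc' : (c : ℝ) ≤ 1 := by exact_mod_cast this
    push_cast; linarith
  have he : (((2 * M + c : ℕ) : ℝ) + 1) * η ^ (2 * M + c) * Γe ≤ 2 * Γe * ((M : ℝ) + 1) * Θ ^ M * μ ^ (2 * M + c) := by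
    have eη : η ^ (2 * M + c) = (η ^ 2 / s) ^ M * s ^ M * η ^ c := by
      rw [div_pow, ← pow_mul, pow_add]; field_simp
    rw [eη, hμpow]
    have h1 : (η ^ 2 / s) ^ M * s ^ M * η ^ c ≤ Θ ^ M * s ^ M * μ ^ c := by
      have a := mul_le_mul_of_nonneg_right hηsM (pow_pos hs M).le
      exact mul_le_mul a hηc (pow_nonneg hη0 _) (by positivity)
    have h2 : (((2 * M + c : ℕ) : ℝ) + 1) * ((η ^ 2 / s) ^ M * s ^ M * η ^ c)
        ≤ (2 * ((M : ℝ) + 1)) * (Θ ^ M * s ^ M * μ ^ c) :=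
      mul_le_mul hN1 h1 (by positivity) (by positivity)
    have h3 := mul_le_mul_of_nonneg_right h2 hΓe0
    calc (((2 * M + c : ℕ) : ℝ) + 1) * ((η ^ 2 / s) ^ M * s ^ M * η ^ c) * Γe
        ≤ (2 * ((M : ℝ) + 1)) * (Θ ^ M * s ^ M * μ ^ c) * Γe := h3
      _ = 2 * Γe * ((M : ℝ) + 1) * Θ ^ M * (s ^ M * μ ^ c) := by ring
  -- assemble
  have hd0 : 0 < |d| := abs_pos.2 hd
  calc |stripZ₂ 1 (2 * M + c) y z - A * μ ^ (2 * M + c)|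
      ≤ (Γc * ((M : ℝ) + 1) * R ^ M * (s / (s - R) ^ 2) + (((2 * M + c : ℕ) : ℝ) + 1) * η ^ (2 * M + c) * Γe) / |d| := h
    _ ≤ (Γc * (s / ((s - R) ^ 2 * μ ^ c)) * ((M : ℝ) + 1) * Θ ^ M * μ ^ (2 * M + c)
          + 2 * Γe * ((M : ℝ) + 1) * Θ ^ M * μ ^ (2 * M + c)) / |d| :=
        div_le_div_of_nonneg_right (add_le_add hb he) hd0.le
    _ = (Γc * (s / ((s - R) ^ 2 * μ ^ c)) + 2 * Γe) / |d| * ((M : ℝ) + 1) * Θ ^ M * μ ^ (2 * M + c) := by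
        field_simp

/-! ## §4 The explicit partial-fraction data `d·P = E·q(X²)(1−yzX⁴)² + U·(1−yzX⁴)² + V·q(X²)` and its first coefficients -/

/-- The coefficient of `X^0` in the partial-fraction numerator `E` (degree ≤ 1) — an integer polynomial in the fugacities. [cite: Stanley2012EC1, §4.1 Theorem 4.1.1 (iii) (partial-fraction data of the strip series; lane computation `kit/pf3.py`, verified by `twoWallP_partialFraction`)] -/
def pfE₀ (y z : ℝ) : ℝ := 2 + 7 * z + 8 * z ^ 2 + 2 * z ^ 3 - 2 * z ^ 4 - z ^ 5 + 7 * y - 18 * y * z ^ 2 - 8 * y * z ^ 3 + 3 * y * z ^ 4 + 8 * y ^ 2 - 18 * y ^ 2 * z + 20 * y ^ 2 * z ^ 2 - 2 * y ^ 2 * z ^ 3 + 2 * y ^ 3 - 8 * y ^ 3 * z - 2 * y ^ 3 * z ^ 2 - 2 * y ^ 4 + 3 * y ^ 4 * z - y ^ 5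

/-- The coefficient of `X^1` in the partial-fraction numerator `E` (degree ≤ 1) — an integer polynomial in the fugacities. [cite: Stanley2012EC1, §4.1 Theorem 4.1.1 (iii) (partial-fraction data of the strip series; lane computation `kit/pf3.py`, verified by `twoWallP_partialFraction`)] -/
def pfE₁ (y z : ℝ) : ℝ := -2 - 8 * z - 12 * z ^ 2 - 8 * z ^ 3 - 2 * z ^ 4 - 8 * y - 8 * y * z + 8 * y * z ^ 2 + 8 * y * z ^ 3 - 12 * y ^ 2 + 8 * y ^ 2 * z - 12 * y ^ 2 * z ^ 2 - 8 * y ^ 3 + 8 * y ^ 3 * z - 2 * y ^ 4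

/-- The coefficient of `X^0` in the partial-fraction numerator `U` (degree ≤ 5, over `q(X²)`) — an integer polynomial in the fugacities. [cite: Stanley2012EC1, §4.1 Theorem 4.1.1 (iii) (partial-fraction data of the strip series; lane computation `kit/pf3.py`, verified by `twoWallP_partialFraction`)] -/
def pfU₀ (y z : ℝ) : ℝ := 4 + 46 * z + 58 * z ^ 2 + 28 * z ^ 3 + 14 * z ^ 4 + 2 * z ^ 5 + 46 * y + 80 * y * z + 44 * y * z ^ 2 - 4 * y * z ^ 3 - 6 * y * z ^ 4 + 58 * y ^ 2 + 44 * y ^ 2 * z - 20 * y ^ 2 * z ^ 2 + 4 * y ^ 2 * z ^ 3 + 28 * y ^ 3 - 4 * y ^ 3 * z + 4 * y ^ 3 * z ^ 2 + 14 * y ^ 4 - 6 * y ^ 4 * z + 2 * y ^ 5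

/-- The coefficient of `X^1` in the partial-fraction numerator `U` (degree ≤ 5, over `q(X²)`) — an integer polynomial in the fugacities. [cite: Stanley2012EC1, §4.1 Theorem 4.1.1 (iii) (partial-fraction data of the strip series; lane computation `kit/pf3.py`, verified by `twoWallP_partialFraction`)] -/
def pfU₁ (y z : ℝ) : ℝ := 4 + 16 * z + 36 * z ^ 2 + 44 * z ^ 3 + 24 * z ^ 4 + 4 * z ^ 5 + 16 * y + 148 * y * z + 124 * y * z ^ 2 + 12 * y * z ^ 3 - 12 * y * z ^ 4 + 36 * y ^ 2 + 124 * y ^ 2 * z - 72 * y ^ 2 * z ^ 2 + 8 * y ^ 2 * z ^ 3 + 44 * y ^ 3 + 12 * y ^ 3 * z + 8 * y ^ 3 * z ^ 2 + 24 * y ^ 4 - 12 * y ^ 4 * z + 4 * y ^ 5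

/-- The coefficient of `X^2` in the partial-fraction numerator `U` (degree ≤ 5, over `q(X²)`) — an integer polynomial in the fugacities. [cite: Stanley2012EC1, §4.1 Theorem 4.1.1 (iii) (partial-fraction data of the strip series; lane computation `kit/pf3.py`, verified by `twoWallP_partialFraction`)] -/
def pfU₂ (y z : ℝ) : ℝ := 10 * z - 4 * z ^ 2 - 6 * z ^ 3 + 8 * z ^ 4 + 10 * y - 12 * y * z + 4 * y * z ^ 2 - 36 * y * z ^ 3 - 26 * y * z ^ 4 - 4 * y * z ^ 5 - 4 * y ^ 2 + 4 * y ^ 2 * z - 88 * y ^ 2 * z ^ 2 + 26 * y ^ 2 * z ^ 3 + 16 * y ^ 2 * z ^ 4 - 6 * y ^ 3 - 36 * y ^ 3 * z + 26 * y ^ 3 * z ^ 2 - 24 * y ^ 3 * z ^ 3 + 8 * y ^ 4 - 26 * y ^ 4 * z + 16 * y ^ 4 * z ^ 2 - 4 * y ^ 5 * z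

/-- The coefficient of `X^3` in the partial-fraction numerator `U` (degree ≤ 5, over `q(X²)`) — an integer polynomial in the fugacities. [cite: Stanley2012EC1, §4.1 Theorem 4.1.1 (iii) (partial-fraction data of the strip series; lane computation `kit/pf3.py`, verified by `twoWallP_partialFraction`)] -/
def pfU₃ (y z : ℝ) : ℝ := 4 * z ^ 2 + 4 * z ^ 3 - 4 * z ^ 4 - 4 * z ^ 5 + 52 * y * z - 16 * y * z ^ 2 - 44 * y * z ^ 3 - 8 * y * z ^ 4 + 4 * y ^ 2 - 16 * y ^ 2 * z - 96 * y ^ 2 * z ^ 2 + 12 * y ^ 2 * z ^ 3 + 4 * y ^ 3 - 44 * y ^ 3 * z + 12 * y ^ 3 * z ^ 2 - 4 * y ^ 4 - 8 * y ^ 4 * z - 4 * y ^ 5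

/-- The coefficient of `X^4` in the partial-fraction numerator `U` (degree ≤ 5, over `q(X²)`) — an integer polynomial in the fugacities. [cite: Stanley2012EC1, §4.1 Theorem 4.1.1 (iii) (partial-fraction data of the strip series; lane computation `kit/pf3.py`, verified by `twoWallP_partialFraction`)] -/
def pfU₄ (y z : ℝ) : ℝ := 2 * z - 4 * z ^ 3 + 2 * z ^ 5 + 2 * y + 8 * y * z + 78 * y * z ^ 2 + 56 * y * z ^ 3 + 20 * y * z ^ 4 + 4 * y * z ^ 5 + 78 * y ^ 2 * z + 32 * y ^ 2 * z ^ 2 - 22 * y ^ 2 * z ^ 3 - 16 * y ^ 2 * z ^ 4 - 4 * y ^ 3 + 56 * y ^ 3 * z - 22 * y ^ 3 * z ^ 2 + 24 * y ^ 3 * z ^ 3 + 20 * y ^ 4 * z - 16 * y ^ 4 * z ^ 2 + 2 * y ^ 5 + 4 * y ^ 5 * z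

/-- The coefficient of `X^5` in the partial-fraction numerator `U` (degree ≤ 5, over `q(X²)`) — an integer polynomial in the fugacities. [cite: Stanley2012EC1, §4.1 Theorem 4.1.1 (iii) (partial-fraction data of the strip series; lane computation `kit/pf3.py`, verified by `twoWallP_partialFraction`)] -/
def pfU₅ (y z : ℝ) : ℝ := 24 * y * z + 36 * y * z ^ 2 + 32 * y * z ^ 3 + 20 * y * z ^ 4 + 36 * y ^ 2 * z + 128 * y ^ 2 * z ^ 2 - 20 * y ^ 2 * z ^ 3 + 32 * y ^ 3 * z - 20 * y ^ 3 * z ^ 2 + 20 * y ^ 4 * z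

/-- The coefficient of `X^0` in the partial-fraction numerator `V` (degree ≤ 7, over `(1 − yzX⁴)²`) — an integer polynomial in the fugacities. [cite: Stanley2012EC1, §4.1 Theorem 4.1.1 (iii) (partial-fraction data of the strip series; lane computation `kit/pf3.py`, verified by `twoWallP_partialFraction`)] -/
def pfV₀ (y z : ℝ) : ℝ := -4 - 44 * z - 50 * z ^ 2 - 16 * z ^ 3 - 6 * z ^ 4 - 44 * y - 64 * y * z - 24 * y * z ^ 2 + 4 * y * z ^ 3 - 50 * y ^ 2 - 24 * y ^ 2 * z + 4 * y ^ 2 * z ^ 2 - 16 * y ^ 3 + 4 * y ^ 3 * z - 6 * y ^ 4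

/-- The coefficient of `X^1` in the partial-fraction numerator `V` (degree ≤ 7, over `(1 − yzX⁴)²`) — an integer polynomial in the fugacities. [cite: Stanley2012EC1, §4.1 Theorem 4.1.1 (iii) (partial-fraction data of the strip series; lane computation `kit/pf3.py`, verified by `twoWallP_partialFraction`)] -/
def pfV₁ (y z : ℝ) : ℝ := 4 * z + 4 * z ^ 2 - 4 * z ^ 3 - 4 * z ^ 4 + 4 * y - 100 * y * z - 100 * y * z ^ 2 - 28 * y * z ^ 3 + 4 * y ^ 2 - 100 * y ^ 2 * z + 64 * y ^ 2 * z ^ 2 - 4 * y ^ 3 - 28 * y ^ 3 * z - 4 * y ^ 4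

/-- The coefficient of `X^2` in the partial-fraction numerator `V` (degree ≤ 7, over `(1 − yzX⁴)²`) — an integer polynomial in the fugacities. [cite: Stanley2012EC1, §4.1 Theorem 4.1.1 (iii) (partial-fraction data of the strip series; lane computation `kit/pf3.py`, verified by `twoWallP_partialFraction`)] -/
def pfV₂ (y z : ℝ) : ℝ := -8 * z - 16 * z ^ 2 - 8 * z ^ 3 - 8 * y - 32 * y * z - 74 * y * z ^ 2 - 28 * y * z ^ 3 - 10 * y * z ^ 4 - 16 * y ^ 2 - 74 * y ^ 2 * z - 24 * y ^ 2 * z ^ 2 + 10 * y ^ 2 * z ^ 3 - 8 * y ^ 3 - 28 * y ^ 3 * z + 10 * y ^ 3 * z ^ 2 - 10 * y ^ 4 * z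

/-- The coefficient of `X^3` in the partial-fraction numerator `V` (degree ≤ 7, over `(1 − yzX⁴)²`) — an integer polynomial in the fugacities. [cite: Stanley2012EC1, §4.1 Theorem 4.1.1 (iii) (partial-fraction data of the strip series; lane computation `kit/pf3.py`, verified by `twoWallP_partialFraction`)] -/
def pfV₃ (y z : ℝ) : ℝ := -44 * y * z - 80 * y * z ^ 2 - 60 * y * z ^ 3 - 24 * y * z ^ 4 - 80 * y ^ 2 * z - 104 * y ^ 2 * z ^ 2 + 24 * y ^ 2 * z ^ 3 - 60 * y ^ 3 * z + 24 * y ^ 3 * z ^ 2 - 24 * y ^ 4 * z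

/-- The coefficient of `X^4` in the partial-fraction numerator `V` (degree ≤ 7, over `(1 − yzX⁴)²`) — an integer polynomial in the fugacities. [cite: Stanley2012EC1, §4.1 Theorem 4.1.1 (iii) (partial-fraction data of the strip series; lane computation `kit/pf3.py`, verified by `twoWallP_partialFraction`)] -/
def pfV₄ (y z : ℝ) : ℝ := 8 * y * z + 42 * y * z ^ 2 + 36 * y * z ^ 3 + 10 * y * z ^ 4 + 8 * y * z ^ 5 + 42 * y ^ 2 * z + 12 * y ^ 2 * z ^ 2 + 30 * y ^ 2 * z ^ 3 - 12 * y ^ 2 * z ^ 4 + 36 * y ^ 3 * z + 30 * y ^ 3 * z ^ 2 + 8 * y ^ 3 * z ^ 3 + 10 * y ^ 4 * z - 12 * y ^ 4 * z ^ 2 + 8 * y ^ 5 * z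

/-- The coefficient of `X^5` in the partial-fraction numerator `V` (degree ≤ 7, over `(1 − yzX⁴)²`) — an integer polynomial in the fugacities. [cite: Stanley2012EC1, §4.1 Theorem 4.1.1 (iii) (partial-fraction data of the strip series; lane computation `kit/pf3.py`, verified by `twoWallP_partialFraction`)] -/
def pfV₅ (y z : ℝ) : ℝ := -4 * y * z - 12 * y * z ^ 2 - 4 * y * z ^ 3 + 12 * y * z ^ 4 + 8 * y * z ^ 5 - 12 * y ^ 2 * z + 92 * y ^ 2 * z ^ 2 + 76 * y ^ 2 * z ^ 3 + 4 * y ^ 2 * z ^ 4 - 4 * y ^ 3 * z + 76 * y ^ 3 * z ^ 2 - 24 * y ^ 3 * z ^ 3 + 12 * y ^ 4 * z + 4 * y ^ 4 * z ^ 2 + 8 * y ^ 5 * z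

/-- The coefficient of `X^6` in the partial-fraction numerator `V` (degree ≤ 7, over `(1 − yzX⁴)²`) — an integer polynomial in the fugacities. [cite: Stanley2012EC1, §4.1 Theorem 4.1.1 (iii) (partial-fraction data of the strip series; lane computation `kit/pf3.py`, verified by `twoWallP_partialFraction`)] -/
def pfV₆ (y z : ℝ) : ℝ := -8 * y * z ^ 3 - 16 * y * z ^ 4 - 8 * y * z ^ 5 - 12 * y ^ 2 * z ^ 2 + 42 * y ^ 2 * z ^ 3 + 32 * y ^ 2 * z ^ 4 + 10 * y ^ 2 * z ^ 5 - 8 * y ^ 3 * z + 42 * y ^ 3 * z ^ 2 + 32 * y ^ 3 * z ^ 3 - 10 * y ^ 3 * z ^ 4 - 16 * y ^ 4 * z + 32 * y ^ 4 * z ^ 2 - 10 * y ^ 4 * z ^ 3 - 8 * y ^ 5 * z + 10 * y ^ 5 * z ^ 2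

/-- The coefficient of `X^7` in the partial-fraction numerator `V` (degree ≤ 7, over `(1 − yzX⁴)²`) — an integer polynomial in the fugacities. [cite: Stanley2012EC1, §4.1 Theorem 4.1.1 (iii) (partial-fraction data of the strip series; lane computation `kit/pf3.py`, verified by `twoWallP_partialFraction`)] -/
def pfV₇ (y z : ℝ) : ℝ := 24 * y ^ 2 * z ^ 2 + 36 * y ^ 2 * z ^ 3 + 32 * y ^ 2 * z ^ 4 + 20 * y ^ 2 * z ^ 5 + 36 * y ^ 3 * z ^ 2 + 128 * y ^ 3 * z ^ 3 - 20 * y ^ 3 * z ^ 4 + 32 * y ^ 4 * z ^ 2 - 20 * y ^ 4 * z ^ 3 + 20 * y ^ 5 * z ^ 2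

set_option maxHeartbeats 400000 in
/-- ★ The explicit partial-fraction decomposition of the two-wall numerator: `d·P(X;y,z) = E·q(X²)(1−yzX⁴)² + U·(1−yzX⁴)² + V·q(X²)`
with `d = ((y−z)² + 2y + 2z + 1)²` and the sixteen polynomials `pfE₀ … pfV₇` (the data of the tree's `tendsto_stripZ₂_one_even_div_pow`),
verified by one `ring`. [cite: Stanley2012EC1, §4.1 Theorem 4.1.1 (iii); BeatonBousquetMelouDeGierDuminilCopinGuttmann2014, §3.2 (arXiv v5 p. 12: the strip series are rational)] -/
theorem twoWallP_partialFraction (y z : ℝ) :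
    C (((y - z) ^ 2 + 2 * y + 2 * z + 1) ^ 2) * twoWallP y z
      = (C (pfE₀ y z) + C (pfE₁ y z) * X)
          * (((1 - C y * X ^ 2) * (1 - C z * X ^ 2) - C y * C z * X ^ 6) * (1 - C y * C z * X ^ 4) ^ 2)
      + (C (pfU₀ y z) + C (pfU₁ y z) * X + C (pfU₂ y z) * X ^ 2 + C (pfU₃ y z) * X ^ 3 + C (pfU₄ y z) * X ^ 4 + C (pfU₅ y z) * X ^ 5)
          * (1 - C y * C z * X ^ 4) ^ 2
      + (C (pfV₀ y z) + C (pfV₁ y z) * X + C (pfV₂ y z) * X ^ 2 + C (pfV₃ y z) * X ^ 3 + C (pfV₄ y z) * X ^ 4 + C (pfV₅ y z) * X ^ 5 + C (pfV₆ y z) * X ^ 6 + C (pfV₇ y z) * X ^ 7)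
          * ((1 - C y * X ^ 2) * (1 - C z * X ^ 2) - C y * C z * X ^ 6) := by
  simp only [pfE₀, pfE₁, pfU₀, pfU₁, pfU₂, pfU₃, pfU₄, pfU₅, pfV₀, pfV₁, pfV₂, pfV₃, pfV₄, pfV₅, pfV₆, pfV₇, twoWallP, map_add, map_sub, map_mul, map_pow, map_neg, map_ofNat, map_one]
  ring


/-- The sixteen coefficient polynomials are continuous in the bottom fugacity `y` (`z` fixed). [cite: Stanley2012EC1, §4.1 Theorem 4.1.1 (iii) (partial-fraction data of the strip series; lane computation `kit/pf3.py`, verified by `twoWallP_partialFraction`)] -/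
theorem continuous_pfCoeffs (z : ℝ) :
    Continuous (fun y : ℝ => pfE₀ y z) ∧
    Continuous (fun y : ℝ => pfE₁ y z) ∧
    Continuous (fun y : ℝ => pfU₀ y z) ∧
    Continuous (fun y : ℝ => pfU₁ y z) ∧
    Continuous (fun y : ℝ => pfU₂ y z) ∧
    Continuous (fun y : ℝ => pfU₃ y z) ∧
    Continuous (fun y : ℝ => pfU₄ y z) ∧
    Continuous (fun y : ℝ => pfU₅ y z) ∧
    Continuous (fun y : ℝ => pfV₀ y z) ∧
    Continuous (fun y : ℝ => pfV₁ y z) ∧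
    Continuous (fun y : ℝ => pfV₂ y z) ∧
    Continuous (fun y : ℝ => pfV₃ y z) ∧
    Continuous (fun y : ℝ => pfV₄ y z) ∧
    Continuous (fun y : ℝ => pfV₅ y z) ∧
    Continuous (fun y : ℝ => pfV₆ y z) ∧
    Continuous (fun y : ℝ => pfV₇ y z) := by
  unfold pfE₀ pfE₁ pfU₀ pfU₁ pfU₂ pfU₃ pfU₄ pfU₅ pfV₀ pfV₁ pfV₂ pfV₃ pfV₄ pfV₅ pfV₆ pfV₇
  refine ⟨?_, ?_, ?_, ?_, ?_, ?_, ?_, ?_, ?_, ?_, ?_, ?_, ?_, ?_, ?_, ?_⟩ <;> fun_prop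

/-- Coefficients of a linear polynomial `a₀ + a₁X`. [cite: Stanley2012EC1, §4.1 (lane plumbing)] -/
theorem coeff_poly2 (a0 a1 : ℝ) :
    coeff 0 (C a0 + C a1 * X) = a0 ∧ coeff 1 (C a0 + C a1 * X) = a1 ∧ ∀ N, coeff (N + 2) (C a0 + C a1 * X) = 0 := by
  refine ⟨?_, ?_, fun N => ?_⟩ <;>
    simp only [map_add, PowerSeries.coeff_C_mul, PowerSeries.coeff_C, coeff_X, Nat.reduceEqDiff, if_false,
      mul_zero, add_zero] <;> norm_num

/-- Coefficients of a quintic polynomial `Σ_{j≤5} a_j X^j`. [cite: Stanley2012EC1, §4.1 (lane plumbing)] -/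
theorem coeff_poly6 (a0 a1 a2 a3 a4 a5 : ℝ) :
    coeff 0 (C a0 + C a1 * X + C a2 * X ^ 2 + C a3 * X ^ 3 + C a4 * X ^ 4 + C a5 * X ^ 5) = a0 ∧
    coeff 1 (C a0 + C a1 * X + C a2 * X ^ 2 + C a3 * X ^ 3 + C a4 * X ^ 4 + C a5 * X ^ 5) = a1 ∧
    coeff 2 (C a0 + C a1 * X + C a2 * X ^ 2 + C a3 * X ^ 3 + C a4 * X ^ 4 + C a5 * X ^ 5) = a2 ∧
    coeff 3 (C a0 + C a1 * X + C a2 * X ^ 2 + C a3 * X ^ 3 + C a4 * X ^ 4 + C a5 * X ^ 5) = a3 ∧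
    coeff 4 (C a0 + C a1 * X + C a2 * X ^ 2 + C a3 * X ^ 3 + C a4 * X ^ 4 + C a5 * X ^ 5) = a4 ∧
    coeff 5 (C a0 + C a1 * X + C a2 * X ^ 2 + C a3 * X ^ 3 + C a4 * X ^ 4 + C a5 * X ^ 5) = a5 ∧
    ∀ N, coeff (N + 6) (C a0 + C a1 * X + C a2 * X ^ 2 + C a3 * X ^ 3 + C a4 * X ^ 4 + C a5 * X ^ 5) = 0 := by
  refine ⟨?_, ?_, ?_, ?_, ?_, ?_, fun N => ?_⟩ <;>
    simp only [map_add, PowerSeries.coeff_C_mul, PowerSeries.coeff_C, coeff_X, PowerSeries.coeff_X_pow,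
      Nat.reduceEqDiff, if_false, mul_zero, add_zero] <;> norm_num

/-- Coefficients of a septic polynomial `Σ_{j≤7} a_j X^j`. [cite: Stanley2012EC1, §4.1 (lane plumbing)] -/
theorem coeff_poly8 (a0 a1 a2 a3 a4 a5 a6 a7 : ℝ) :
    coeff 0 (C a0 + C a1 * X + C a2 * X ^ 2 + C a3 * X ^ 3 + C a4 * X ^ 4 + C a5 * X ^ 5 + C a6 * X ^ 6 + C a7 * X ^ 7) = a0 ∧
    coeff 1 (C a0 + C a1 * X + C a2 * X ^ 2 + C a3 * X ^ 3 + C a4 * X ^ 4 + C a5 * X ^ 5 + C a6 * X ^ 6 + C a7 * X ^ 7) = a1 ∧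
    coeff 2 (C a0 + C a1 * X + C a2 * X ^ 2 + C a3 * X ^ 3 + C a4 * X ^ 4 + C a5 * X ^ 5 + C a6 * X ^ 6 + C a7 * X ^ 7) = a2 ∧
    coeff 3 (C a0 + C a1 * X + C a2 * X ^ 2 + C a3 * X ^ 3 + C a4 * X ^ 4 + C a5 * X ^ 5 + C a6 * X ^ 6 + C a7 * X ^ 7) = a3 ∧
    coeff 4 (C a0 + C a1 * X + C a2 * X ^ 2 + C a3 * X ^ 3 + C a4 * X ^ 4 + C a5 * X ^ 5 + C a6 * X ^ 6 + C a7 * X ^ 7) = a4 ∧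
    coeff 5 (C a0 + C a1 * X + C a2 * X ^ 2 + C a3 * X ^ 3 + C a4 * X ^ 4 + C a5 * X ^ 5 + C a6 * X ^ 6 + C a7 * X ^ 7) = a5 ∧
    coeff 6 (C a0 + C a1 * X + C a2 * X ^ 2 + C a3 * X ^ 3 + C a4 * X ^ 4 + C a5 * X ^ 5 + C a6 * X ^ 6 + C a7 * X ^ 7) = a6 ∧
    coeff 7 (C a0 + C a1 * X + C a2 * X ^ 2 + C a3 * X ^ 3 + C a4 * X ^ 4 + C a5 * X ^ 5 + C a6 * X ^ 6 + C a7 * X ^ 7) = a7 ∧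
    ∀ N, coeff (N + 8) (C a0 + C a1 * X + C a2 * X ^ 2 + C a3 * X ^ 3 + C a4 * X ^ 4 + C a5 * X ^ 5 + C a6 * X ^ 6 + C a7 * X ^ 7)
      = 0 := by
  refine ⟨?_, ?_, ?_, ?_, ?_, ?_, ?_, ?_, fun N => ?_⟩ <;>
    simp only [map_add, PowerSeries.coeff_C_mul, PowerSeries.coeff_C, coeff_X, PowerSeries.coeff_X_pow,
      Nat.reduceEqDiff, if_false, mul_zero, add_zero] <;> norm_num

/-- The first six coefficients of `φ = U/q(X²)` in terms of those of `U` (`q(u) = (1−yu)(1−zu) − yzu³`).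
[cite: Stanley2012EC1, §4.1 (Theorem 4.1.1)] -/
private theorem coeff_init_six' {φ U : ℝ⟦X⟧}
    (h : φ * ((1 - C y * X ^ 2) * (1 - C z * X ^ 2) - C y * C z * X ^ 6) = U) :
    coeff 0 φ = coeff 0 U ∧ coeff 1 φ = coeff 1 U ∧ coeff 2 φ = coeff 2 U + (y + z) * coeff 0 φ
      ∧ coeff 3 φ = coeff 3 U + (y + z) * coeff 1 φ
      ∧ coeff 4 φ = coeff 4 U + (y + z) * coeff 2 φ - y * z * coeff 0 φ
      ∧ coeff 5 φ = coeff 5 U + (y + z) * coeff 3 φ - y * z * coeff 1 φ := by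
  set p₁ : ℝ := y + z with hp₁
  set p₂ : ℝ := y * z with hp₂
  have h' : φ = U + C p₁ * (φ * X ^ 2) - C p₂ * (φ * X ^ 4) + C p₂ * (φ * X ^ 6) := by
    simp only [hp₁, hp₂, map_add, map_mul]
    linear_combination h
  have h0 := congrArg (coeff 0) h'
  have h1 := congrArg (coeff 1) h'
  have h2 := congrArg (coeff 2) h'
  have h3 := congrArg (coeff 3) h'
  have h4 := congrArg (coeff 4) h'
  have h5 := congrArg (coeff 5) h'
  simp only [map_add, map_sub, PowerSeries.coeff_C_mul, PowerSeries.coeff_mul_X_pow'] at h0 h1 h2 h3 h4 h5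
  norm_num at h0 h1 h2 h3 h4 h5
  rw [← PowerSeries.coeff_zero_eq_constantCoeff_apply, ← PowerSeries.coeff_zero_eq_constantCoeff_apply] at h0
  rw [← PowerSeries.coeff_zero_eq_constantCoeff_apply] at h2 h4
  exact ⟨h0, h1, by linear_combination h2, by linear_combination h3, by linear_combination h4,
    by linear_combination h5⟩

/-- The first eight coefficients of `φ = V/(1 − yzX⁴)²` in terms of those of `V`.
[cite: Stanley2012EC1, §4.1 (Theorem 4.1.1)] -/
theorem coeff_init_eight' {φ V : ℝ⟦X⟧} (h : φ * (1 - C y * C z * X ^ 4) ^ 2 = V) :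
    coeff 0 φ = coeff 0 V ∧ coeff 1 φ = coeff 1 V ∧ coeff 2 φ = coeff 2 V ∧ coeff 3 φ = coeff 3 V ∧
      coeff 4 φ = coeff 4 V + 2 * (y * z) * coeff 0 φ ∧ coeff 5 φ = coeff 5 V + 2 * (y * z) * coeff 1 φ ∧
      coeff 6 φ = coeff 6 V + 2 * (y * z) * coeff 2 φ ∧ coeff 7 φ = coeff 7 V + 2 * (y * z) * coeff 3 φ := by
  set p₂ : ℝ := y * z with hp₂
  have h' : φ = V + C (2 * p₂) * (φ * X ^ 4) - C (p₂ ^ 2) * (φ * X ^ 8) := by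
    simp only [hp₂, map_mul, map_pow, map_ofNat]
    linear_combination h
  have h0 := congrArg (coeff 0) h'
  have h1 := congrArg (coeff 1) h'
  have h2 := congrArg (coeff 2) h'
  have h3 := congrArg (coeff 3) h'
  have h4 := congrArg (coeff 4) h'
  have h5 := congrArg (coeff 5) h'
  have h6 := congrArg (coeff 6) h'
  have h7 := congrArg (coeff 7) h'
  simp only [map_add, map_sub, PowerSeries.coeff_C_mul, PowerSeries.coeff_mul_X_pow'] at h0 h1 h2 h3 h4 h5 h6 h7
  norm_num at h0 h1 h2 h3 h4 h5 h6 h7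
  rw [← PowerSeries.coeff_zero_eq_constantCoeff_apply, ← PowerSeries.coeff_zero_eq_constantCoeff_apply] at h0
  rw [← PowerSeries.coeff_zero_eq_constantCoeff_apply] at h4
  exact ⟨h0, h1, h2, h3, by linear_combination h4, by linear_combination h5, by linear_combination h6,
    by linear_combination h7⟩

/-! ## §5 Uniform two-term asymptotics on compact fugacity intervals -/

/-- ★★★ **UNIFORM TWO-TERM ASYMPTOTICS.**  For `z > 0` and `0 < y₁ ≤ y₂` there are constants `K ≥ 0` and `Θ ∈ [0, 1)` such that for EVERY
`y ∈ [y₁, y₂]`, every parity `c ∈ {0, 1}` and every `M ≥ 1`,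
`|C_{1,2M+c}(y,z) − A_c(y,z)·μ₁(y,z)^{2M+c}| ≤ K·(M+1)·Θ^M·μ₁(y,z)^{2M+c}`,
where `A_c(y,z) = lim_M C_{1,2M+c}(y,z)/μ₁(y,z)^{2M+c}` is the parity amplitude (tree: `tendsto_stripZ₂_one_even_div_pow`,
`tendsto_stripZ₂_one_odd_div_pow`; here any limit value `A` may be supplied).  All constants of the rate form (§3) are continuous
functions of `y` through the sixteen polynomials of §4, `s = μ₁(y,z)²` (continuous: `continuousOn_stripMuY₂`) and
`R = quadRootBound` (continuous: CAR «DOMINANT ROOT»), and `Θ(y) < 1` pointwise (§1) — so compactness gives the uniform constants.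
[cite: Stanley2012EC1, §4.1 Theorem 4.1.1 (iii) (lane statement, uniform in a parameter); BeatonBousquetMelouDeGierDuminilCopinGuttmann2014, §3.2 (arXiv v5 p. 10: C_{T,N}(y,z); Proposition 6: μ_T(y,z) continuous; p. 12); MadrasSlade1993, §1.1 eq. (1.1.4) p. 5] -/
theorem exists_uniform_two_term (hz : 0 < z) {y₁ y₂ : ℝ} (hy₁ : 0 < y₁) (h12 : y₁ ≤ y₂) :
    ∃ K Θ : ℝ, 0 ≤ K ∧ 0 ≤ Θ ∧ Θ < 1 ∧
      ∀ y ∈ Set.Icc y₁ y₂, ∀ c < 2, ∀ A : ℝ,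
        Tendsto (fun M => stripZ₂ 1 (2 * M + c) y z / stripMuY₂ 1 y z ^ (2 * M + c)) atTop (𝓝 A) →
        ∀ M, 1 ≤ M → |stripZ₂ 1 (2 * M + c) y z - A * stripMuY₂ 1 y z ^ (2 * M + c)|
          ≤ K * ((M : ℝ) + 1) * Θ ^ M * stripMuY₂ 1 y z ^ (2 * M + c) := by
  set S : Set ℝ := Set.Icc y₁ y₂ with hSdef
  have hSpos : ∀ y ∈ S, 0 < y := fun y hy => lt_of_lt_of_le hy₁ hy.1
  have hne : S.Nonempty := ⟨y₁, le_rfl, h12⟩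
  -- the explicit coefficient functions (first coefficients of `U/q(X²)` and `V/(1−yzX⁴)²`, by `coeff_init_six'/eight'`)
  set Wc : ℕ → ℝ → ℝ := fun j y => match j with
    | 0 => pfU₀ y z
    | 1 => pfU₁ y z
    | 2 => pfU₂ y z + (y + z) * pfU₀ y z
    | 3 => pfU₃ y z + (y + z) * pfU₁ y z
    | 4 => pfU₄ y z + (y + z) * (pfU₂ y z + (y + z) * pfU₀ y z) - y * z * pfU₀ y z
    | 5 => pfU₅ y z + (y + z) * (pfU₃ y z + (y + z) * pfU₁ y z) - y * z * pfU₁ y z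
    | _ => 0 with hWc
  set Ec : ℕ → ℝ → ℝ := fun j y => match j with
    | 0 => pfV₀ y z
    | 1 => pfV₁ y z
    | 2 => pfV₂ y z
    | 3 => pfV₃ y z
    | 4 => pfV₄ y z + 2 * (y * z) * pfV₀ y z
    | 5 => pfV₅ y z + 2 * (y * z) * pfV₁ y z
    | 6 => pfV₆ y z + 2 * (y * z) * pfV₂ y z
    | 7 => pfV₇ y z + 2 * (y * z) * pfV₃ y z
    | _ => 0 with hEc
  -- the rate and the constant, as functions of `y` (literally the right side of `abs_sub_le_rate_of_decomposition`)
  set Θf : ℝ → ℝ := fun y =>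
    max (quadRootBound (stripMuY₂ 1 y z ^ 2 - y - z) (y * z / stripMuY₂ 1 y z ^ 2) / stripMuY₂ 1 y z ^ 2)
      (Real.sqrt (y * z) / stripMuY₂ 1 y z ^ 2) with hΘf
  set Kc : ℕ → ℝ → ℝ := fun c y =>
    ((|Wc (c + 2) y - stripMuY₂ 1 y z ^ 2 * Wc c y|
          + |Wc (c + 4) y - stripMuY₂ 1 y z ^ 2 * Wc (c + 2) y|
            / quadRootBound (stripMuY₂ 1 y z ^ 2 - y - z) (y * z / stripMuY₂ 1 y z ^ 2))
        * (stripMuY₂ 1 y z ^ 2 /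
          ((stripMuY₂ 1 y z ^ 2 - quadRootBound (stripMuY₂ 1 y z ^ 2 - y - z) (y * z / stripMuY₂ 1 y z ^ 2)) ^ 2
            * stripMuY₂ 1 y z ^ c))
      + 2 * ∑ j ∈ range 4, (|Ec j y| + |Ec (j + 4) y| / (y * z)) / Real.sqrt (Real.sqrt (y * z)) ^ j)
    / |((y - z) ^ 2 + 2 * y + 2 * z + 1) ^ 2| with hKc
  -- continuity on `S`
  have hμc : ContinuousOn (fun y => stripMuY₂ 1 y z) S := by
    intro y hyS
    have hy0 : 0 < y := hSpos y hyS
    have h : ContinuousAt (fun p : ℝ × ℝ => stripMuY₂ 1 p.1 p.2) (y, z) :=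
      (continuousOn_stripMuY₂ 1).continuousAt ((isOpen_Ioi.prod isOpen_Ioi).mem_nhds ⟨hy0, hz⟩)
    have hg : ContinuousAt (fun y' : ℝ => (y', z)) y := continuousAt_id.prodMk continuousAt_const
    exact (ContinuousAt.comp (f := fun y' : ℝ => (y', z)) (g := fun p : ℝ × ℝ => stripMuY₂ 1 p.1 p.2) h hg).continuousWithinAt
  have hμ0 : ∀ y ∈ S, stripMuY₂ 1 y z ≠ 0 := fun y hy => (stripMuY₂_pos 1 (hSpos y hy) hz).ne'
  have hs0 : ∀ y ∈ S, stripMuY₂ 1 y z ^ 2 ≠ 0 := fun y hy => pow_ne_zero 2 (hμ0 y hy)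
  have hR0 : ∀ y ∈ S, quadRootBound (stripMuY₂ 1 y z ^ 2 - y - z) (y * z / stripMuY₂ 1 y z ^ 2) ≠ 0 :=
    fun y hy => (quadRootBound_cofactor_lt (hSpos y hy) hz).1.ne'
  have hsR0 : ∀ y ∈ S, (stripMuY₂ 1 y z ^ 2 - quadRootBound (stripMuY₂ 1 y z ^ 2 - y - z) (y * z / stripMuY₂ 1 y z ^ 2)) ^ 2
      * stripMuY₂ 1 y z ^ (0 : ℕ) ≠ 0 := fun y hy =>
    mul_ne_zero (pow_ne_zero 2 (sub_pos.2 (quadRootBound_cofactor_lt (hSpos y hy) hz).2).ne') (pow_ne_zero _ (hμ0 y hy))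
  have hsR1 : ∀ y ∈ S, (stripMuY₂ 1 y z ^ 2 - quadRootBound (stripMuY₂ 1 y z ^ 2 - y - z) (y * z / stripMuY₂ 1 y z ^ 2)) ^ 2
      * stripMuY₂ 1 y z ^ (1 : ℕ) ≠ 0 := fun y hy =>
    mul_ne_zero (pow_ne_zero 2 (sub_pos.2 (quadRootBound_cofactor_lt (hSpos y hy) hz).2).ne') (pow_ne_zero _ (hμ0 y hy))
  have hyz0 : ∀ y ∈ S, y * z ≠ 0 := fun y hy => (mul_pos (hSpos y hy) hz).ne'
  have hη0 : ∀ y ∈ S, ∀ j : ℕ, Real.sqrt (Real.sqrt (y * z)) ^ j ≠ 0 := fun y hy j =>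
    pow_ne_zero j (Real.sqrt_pos.2 (Real.sqrt_pos.2 (mul_pos (hSpos y hy) hz))).ne'
  have hd0 : ∀ y ∈ S, |((y - z) ^ 2 + 2 * y + 2 * z + 1) ^ 2| ≠ 0 := fun y hy => by
    have : 0 < ((y - z) ^ 2 + 2 * y + 2 * z + 1) ^ 2 := by have := hSpos y hy; positivity
    exact (abs_pos.2 this.ne').ne'
  obtain ⟨cE0, cE1, cU0, cU1, cU2, cU3, cU4, cU5, cV0, cV1, cV2, cV3, cV4, cV5, cV6, cV7⟩ := continuous_pfCoeffs z
  have hRc : ContinuousOn (fun y => quadRootBound (stripMuY₂ 1 y z ^ 2 - y - z) (y * z / stripMuY₂ 1 y z ^ 2)) S := by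
    unfold quadRootBound
    fun_prop (disch := assumption)
  have hWcc : ∀ j, ContinuousOn (fun y => Wc j y) S := by
    intro j
    match j with
    | 0 => exact cU0.continuousOn
    | 1 => exact cU1.continuousOn
    | 2 => show ContinuousOn (fun y => pfU₂ y z + (y + z) * pfU₀ y z) S; fun_prop
    | 3 => show ContinuousOn (fun y => pfU₃ y z + (y + z) * pfU₁ y z) S; fun_prop
    | 4 => show ContinuousOn (fun y => pfU₄ y z + (y + z) * (pfU₂ y z + (y + z) * pfU₀ y z) - y * z * pfU₀ y z) S; fun_prop
    | 5 => show ContinuousOn (fun y => pfU₅ y z + (y + z) * (pfU₃ y z + (y + z) * pfU₁ y z) - y * z * pfU₁ y z) S; fun_prop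
    | (n + 6) => exact continuousOn_const
  have hEcc : ∀ j, ContinuousOn (fun y => Ec j y) S := by
    intro j
    match j with
    | 0 => exact cV0.continuousOn
    | 1 => exact cV1.continuousOn
    | 2 => exact cV2.continuousOn
    | 3 => exact cV3.continuousOn
    | 4 => show ContinuousOn (fun y => pfV₄ y z + 2 * (y * z) * pfV₀ y z) S; fun_prop
    | 5 => show ContinuousOn (fun y => pfV₅ y z + 2 * (y * z) * pfV₁ y z) S; fun_prop
    | 6 => show ContinuousOn (fun y => pfV₆ y z + 2 * (y * z) * pfV₂ y z) S; fun_prop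
    | 7 => show ContinuousOn (fun y => pfV₇ y z + 2 * (y * z) * pfV₃ y z) S; fun_prop
    | (n + 8) => exact continuousOn_const
  have hΘc : ContinuousOn Θf S := by
    rw [hΘf]
    fun_prop (disch := assumption)
  have hΓec : ContinuousOn
      (fun y => ∑ j ∈ range 4, (|Ec j y| + |Ec (j + 4) y| / (y * z)) / Real.sqrt (Real.sqrt (y * z)) ^ j) S := by
    refine continuousOn_finsetSum _ fun j _ => ?_
    have h1 := hEcc j
    have h2 := hEcc (j + 4)
    have h3 : ∀ y ∈ S, Real.sqrt (Real.sqrt (y * z)) ^ j ≠ 0 := fun y hy => hη0 y hy j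
    fun_prop (disch := assumption)
  have hKcc : ∀ c < 2, ContinuousOn (Kc c) S := by
    intro c hc
    have h1 := hWcc c
    have h2 := hWcc (c + 2)
    have h3 := hWcc (c + 4)
    have h4 : ∀ y ∈ S, (stripMuY₂ 1 y z ^ 2 - quadRootBound (stripMuY₂ 1 y z ^ 2 - y - z) (y * z / stripMuY₂ 1 y z ^ 2)) ^ 2
        * stripMuY₂ 1 y z ^ c ≠ 0 := by
      interval_cases c
      · exact hsR0
      · exact hsR1
    rw [hKc]
    fun_prop (disch := assumption)
  -- `K := max_S (Kc 0 + Kc 1)`, `Θ := max_S Θf`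
  have hKsum : ContinuousOn (fun y => Kc 0 y + Kc 1 y) S := (hKcc 0 (by norm_num)).add (hKcc 1 (by norm_num))
  obtain ⟨yK, hyK, hKmax⟩ := isCompact_Icc.exists_isMaxOn hne hKsum
  obtain ⟨yΘ, hyΘ, hΘmax⟩ := isCompact_Icc.exists_isMaxOn hne hΘc
  have hKc0 : ∀ c, ∀ y ∈ S, 0 ≤ Kc c y := by
    intro c y hy
    rw [hKc]
    have := quadRootBound_nonneg (stripMuY₂ 1 y z ^ 2 - y - z) (y * z / stripMuY₂ 1 y z ^ 2)
    have hy0 : 0 < y := hSpos y hy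
    have hμ := stripMuY₂_pos 1 hy0 hz
    apply div_nonneg _ (abs_nonneg _)
    apply add_nonneg
    · apply mul_nonneg (by positivity)
      apply div_nonneg (by positivity) (by positivity)
    · exact mul_nonneg (by norm_num) (Finset.sum_nonneg fun j _ => by positivity)
  have hΘf0 : ∀ y ∈ S, 0 ≤ Θf y ∧ Θf y < 1 := fun y hy => by
    obtain ⟨h0, h1, -⟩ := twoTermRate_facts (hSpos y hy) hz
    exact ⟨h0, h1⟩
  refine ⟨Kc 0 yK + Kc 1 yK, Θf yΘ, add_nonneg (hKc0 0 yK hyK) (hKc0 1 yK hyK), (hΘf0 yΘ hyΘ).1, (hΘf0 yΘ hyΘ).2, ?_⟩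
  -- the estimate at a point `y ∈ S`
  intro y hy c hc A hA M hM
  have hy0 : 0 < y := hSpos y hy
  have hμ := stripMuY₂_pos 1 hy0 hz
  set qX : ℝ⟦X⟧ := (1 - C y * X ^ 2) * (1 - C z * X ^ 2) - C y * C z * X ^ 6 with hqX
  set Q2 : ℝ⟦X⟧ := (1 - C y * C z * X ^ 4) ^ 2 with hQ2
  set iq : ℝ⟦X⟧ := PowerSeries.invOfUnit qX 1 with hiq
  set iQ : ℝ⟦X⟧ := PowerSeries.invOfUnit Q2 1 with hiQ
  have hqinv : qX * iq = 1 := PowerSeries.mul_invOfUnit qX 1 (by simp [hqX])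
  have hQinv : Q2 * iQ = 1 := PowerSeries.mul_invOfUnit Q2 1 (by simp [hQ2])
  have hPF := twoWallP_partialFraction y z
  obtain ⟨dE0, dE1, hEdeg⟩ := coeff_poly2 (pfE₀ y z) (pfE₁ y z)
  obtain ⟨dU0, dU1, dU2, dU3, dU4, dU5, hUdeg⟩ := coeff_poly6 (pfU₀ y z) (pfU₁ y z) (pfU₂ y z) (pfU₃ y z) (pfU₄ y z) (pfU₅ y z)
  obtain ⟨dV0, dV1, dV2, dV3, dV4, dV5, dV6, dV7, hVdeg⟩ :=
    coeff_poly8 (pfV₀ y z) (pfV₁ y z) (pfV₂ y z) (pfV₃ y z) (pfV₄ y z) (pfV₅ y z) (pfV₆ y z) (pfV₇ y z)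
  have hd : ((y - z) ^ 2 + 2 * y + 2 * z + 1) ^ 2 ≠ 0 := by positivity
  set U : ℝ⟦X⟧ := C (pfU₀ y z) + C (pfU₁ y z) * X + C (pfU₂ y z) * X ^ 2 + C (pfU₃ y z) * X ^ 3 + C (pfU₄ y z) * X ^ 4
    + C (pfU₅ y z) * X ^ 5 with hUdef
  set V : ℝ⟦X⟧ := C (pfV₀ y z) + C (pfV₁ y z) * X + C (pfV₂ y z) * X ^ 2 + C (pfV₃ y z) * X ^ 3 + C (pfV₄ y z) * X ^ 4
    + C (pfV₅ y z) * X ^ 5 + C (pfV₆ y z) * X ^ 6 + C (pfV₇ y z) * X ^ 7 with hVdef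
  have h := abs_sub_le_rate_of_decomposition hy0 hz hd hPF hEdeg hUdeg hVdeg hqinv hQinv hc hA hM
  -- the first coefficients of `U·iq` and `V·iQ`
  have hUiq : U * iq * ((1 - C y * X ^ 2) * (1 - C z * X ^ 2) - C y * C z * X ^ 6) = U := by
    rw [← hqX, mul_assoc, mul_comm iq qX, hqinv, mul_one]
  obtain ⟨g0, g1, g2, g3, g4, g5⟩ := coeff_init_six' hUiq
  rw [dU0] at g0; rw [dU1] at g1; rw [dU2, g0] at g2; rw [dU3, g1] at g3; rw [dU4, g2, g0] at g4; rw [dU5, g3, g1] at g5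
  have hWv : ∀ j, j ≤ 5 → coeff j (U * iq) = Wc j y := by
    intro j hj
    interval_cases j
    · exact g0
    · exact g1
    · exact g2
    · exact g3
    · exact g4
    · exact g5
  have hViQ : V * iQ * (1 - C y * C z * X ^ 4) ^ 2 = V := by
    rw [← hQ2, mul_assoc, mul_comm iQ Q2, hQinv, mul_one]
  obtain ⟨f0, f1, f2, f3, f4, f5, f6, f7⟩ := coeff_init_eight' hViQ
  rw [dV0] at f0; rw [dV1] at f1; rw [dV2] at f2; rw [dV3] at f3
  rw [dV4, f0] at f4; rw [dV5, f1] at f5; rw [dV6, f2] at f6; rw [dV7, f3] at f7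
  have hEv : ∀ j, j ≤ 7 → coeff j (V * iQ) = Ec j y := by
    intro j hj
    interval_cases j
    · exact f0
    · exact f1
    · exact f2
    · exact f3
    · exact f4
    · exact f5
    · exact f6
    · exact f7
  have hsum : ∑ j ∈ range 4, (|coeff j (V * iQ)| + |coeff (j + 4) (V * iQ)| / (y * z)) / Real.sqrt (Real.sqrt (y * z)) ^ j
      = ∑ j ∈ range 4, (|Ec j y| + |Ec (j + 4) y| / (y * z)) / Real.sqrt (Real.sqrt (y * z)) ^ j := by
    refine Finset.sum_congr rfl fun j hj => ?_
    have hj4 : j < 4 := Finset.mem_range.1 hj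
    rw [hEv j (by omega), hEv (j + 4) (by omega)]
  rw [hWv (c + 2) (by omega), hWv c (by omega), hWv (c + 4) (by omega), hsum] at h
  -- `h` is now literally `… ≤ Kc c y * (M+1) * Θf y ^ M * μ^{2M+c}`
  have h' : |stripZ₂ 1 (2 * M + c) y z - A * stripMuY₂ 1 y z ^ (2 * M + c)|
      ≤ Kc c y * ((M : ℝ) + 1) * Θf y ^ M * stripMuY₂ 1 y z ^ (2 * M + c) := h
  -- monotonicity in the constants
  have hKle : Kc c y ≤ Kc 0 yK + Kc 1 yK := by
    have hsum_le : Kc 0 y + Kc 1 y ≤ Kc 0 yK + Kc 1 yK := hKmax hy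
    have h0 := hKc0 0 y hy
    have h1 := hKc0 1 y hy
    interval_cases c <;> linarith
  have hΘle : Θf y ^ M ≤ Θf yΘ ^ M := pow_le_pow_left₀ (hΘf0 y hy).1 (hΘmax hy) M
  have hμN : 0 ≤ stripMuY₂ 1 y z ^ (2 * M + c) := (pow_pos hμ _).le
  calc |stripZ₂ 1 (2 * M + c) y z - A * stripMuY₂ 1 y z ^ (2 * M + c)|
      ≤ Kc c y * ((M : ℝ) + 1) * Θf y ^ M * stripMuY₂ 1 y z ^ (2 * M + c) := h'
    _ ≤ (Kc 0 yK + Kc 1 yK) * ((M : ℝ) + 1) * Θf yΘ ^ M * stripMuY₂ 1 y z ^ (2 * M + c) := by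
        have a : Kc c y * ((M : ℝ) + 1) ≤ (Kc 0 yK + Kc 1 yK) * ((M : ℝ) + 1) :=
          mul_le_mul_of_nonneg_right hKle (by positivity)
        have b : Kc c y * ((M : ℝ) + 1) * Θf y ^ M ≤ (Kc 0 yK + Kc 1 yK) * ((M : ℝ) + 1) * Θf yΘ ^ M :=
          mul_le_mul a hΘle (pow_nonneg (hΘf0 y hy).1 M) (mul_nonneg (add_nonneg (hKc0 0 yK hyK) (hKc0 1 yK hyK)) (by positivity))
        exact mul_le_mul_of_nonneg_right b hμN

/-! ## §6 The logarithmic form: the remainder input of the variance theorem -/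

/-- `a ≤ x ≤ b ⇒ |x| ≤ |a| + |b|`. [cite: Stanley2012EC1, §4.1 (lane plumbing)] -/
theorem abs_le_abs_add_abs_of_mem {a b x : ℝ} (ha : a ≤ x) (hb : x ≤ b) : |x| ≤ |a| + |b| := by
  rcases le_or_gt 0 x with h | h
  · rw [abs_of_nonneg h]; linarith [le_abs_self b, abs_nonneg a]
  · rw [abs_of_neg h]; linarith [neg_abs_le a, abs_nonneg b]

/-- ★★★ **UNIFORM TWO-TERM ASYMPTOTICS, LOGARITHMIC FORM** — the `hr`/`hε` input of the tree's
`Literature.Analysis.tendsto_deriv2_div_of_quasiLinear` (`QuasiLinearSecondDerivative`).  Let `z > 0`, `0 < y₁ ≤ y₂`, `c ∈ {0,1}`, and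
let `A : ℝ → ℝ` give the parity amplitude on `[y₁, y₂]` (`C_{1,2M+c}(y,z)/μ₁(y,z)^{2M+c} → A(y)`) with `0 < a₁ ≤ A ≤ a₂` there.  Then there is
`ε : ℕ → ℝ` with `M·ε_M → 0` such that for ALL `M` and all `y ∈ [y₁, y₂]`,
`|log C_{1,2M+c}(y,z) − (2M+c)·log μ₁(y,z) − log A(y)| ≤ ε_M`
(for large `M`: `ε_M = 2K(M+1)Θ^M/a₁` from `exists_uniform_two_term`; for the finitely many small `M`: monotonicity of `C_{1,N}` and `μ₁` in `y`).
With `y = y₀e^t` this is `|F_N(t) − N·φ(t) − G(t)| ≤ ε` uniformly on `|t| < τ` along each parity, `F_N = log C_{1,N}(y₀e^t, z)`,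
`φ = log μ₁(y₀e^t, z)`, `G = log A`. [cite: DemboZeitouni2010, §2.3 (Gärtner–Ellis; lane statement: the second-order free-energy expansion); Stanley2012EC1, §4.1 Theorem 4.1.1 (iii); BeatonBousquetMelouDeGierDuminilCopinGuttmann2014, §3.2 (arXiv v5 p. 10: C_{T,N}(y,z), Proposition 6)] -/
theorem exists_uniform_log_two_term (hz : 0 < z) {y₁ y₂ : ℝ} (hy₁ : 0 < y₁) (h12 : y₁ ≤ y₂) {c : ℕ} (hc : c < 2)
    {A : ℝ → ℝ} {a₁ a₂ : ℝ} (ha₁ : 0 < a₁) (hA : ∀ y ∈ Set.Icc y₁ y₂, a₁ ≤ A y ∧ A y ≤ a₂)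
    (hlim : ∀ y ∈ Set.Icc y₁ y₂,
      Tendsto (fun M => stripZ₂ 1 (2 * M + c) y z / stripMuY₂ 1 y z ^ (2 * M + c)) atTop (𝓝 (A y))) :
    ∃ ε : ℕ → ℝ, Tendsto (fun M : ℕ => (M : ℝ) * ε M) atTop (𝓝 0) ∧
      ∀ M : ℕ, ∀ y ∈ Set.Icc y₁ y₂,
        |Real.log (stripZ₂ 1 (2 * M + c) y z) - (2 * M + c) * Real.log (stripMuY₂ 1 y z) - Real.log (A y)| ≤ ε M := by
  obtain ⟨K, Θ, hK0, hΘ0, hΘ1, hbound⟩ := exists_uniform_two_term hz hy₁ h12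
  have hy₂ : 0 < y₂ := lt_of_lt_of_le hy₁ h12
  have ha₂ : 0 < a₂ := by obtain ⟨h1, h2⟩ := hA y₁ ⟨le_rfl, h12⟩; linarith
  -- the relative error `δ_M = K(M+1)Θ^M/a₁ → 0`
  set δ : ℕ → ℝ := fun M => K * ((M : ℝ) + 1) * Θ ^ M / a₁ with hδ
  have hδ0 : ∀ M, 0 ≤ δ M := fun M => by positivity
  have hΘabs : |Θ| < 1 := by rw [abs_of_nonneg hΘ0]; exact hΘ1
  have hgeo1 : Tendsto (fun M : ℕ => (M : ℝ) ^ 1 * Θ ^ M) atTop (𝓝 0) := tendsto_pow_const_mul_const_pow_of_abs_lt_one 1 hΘabs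
  have hgeo2 : Tendsto (fun M : ℕ => (M : ℝ) ^ 2 * Θ ^ M) atTop (𝓝 0) := tendsto_pow_const_mul_const_pow_of_abs_lt_one 2 hΘabs
  have hgeo0 : Tendsto (fun M : ℕ => Θ ^ M) atTop (𝓝 0) := tendsto_pow_atTop_nhds_zero_of_lt_one hΘ0 hΘ1
  have hδlim : Tendsto δ atTop (𝓝 0) := by
    have : Tendsto (fun M : ℕ => K / a₁ * ((M : ℝ) ^ 1 * Θ ^ M) + K / a₁ * Θ ^ M) atTop (𝓝 (K / a₁ * 0 + K / a₁ * 0)) :=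
      (hgeo1.const_mul _).add (hgeo0.const_mul _)
    rw [mul_zero, add_zero] at this
    refine this.congr fun M => ?_
    simp only [hδ, pow_one]; field_simp
  have hMδlim : Tendsto (fun M : ℕ => (M : ℝ) * (2 * δ M)) atTop (𝓝 0) := by
    have : Tendsto (fun M : ℕ => 2 * K / a₁ * ((M : ℝ) ^ 2 * Θ ^ M) + 2 * K / a₁ * ((M : ℝ) ^ 1 * Θ ^ M)) atTop
        (𝓝 (2 * K / a₁ * 0 + 2 * K / a₁ * 0)) := (hgeo2.const_mul _).add (hgeo1.const_mul _)
    rw [mul_zero, add_zero] at this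
    refine this.congr fun M => ?_
    simp only [hδ, pow_one]; field_simp
  -- `δ_M ≤ 1/2` eventually
  obtain ⟨M₁, hM₁⟩ : ∃ M₁ : ℕ, ∀ M ≥ M₁, δ M ≤ 1 / 2 := by
    have h := (Metric.tendsto_atTop.1 hδlim) (1 / 2) (by norm_num)
    obtain ⟨M₁, hM₁⟩ := h
    refine ⟨M₁, fun M hM => ?_⟩
    have := hM₁ M hM
    rw [Real.dist_eq, sub_zero, abs_of_nonneg (hδ0 M)] at this
    exact this.le
  -- the crude bound for small `M`
  set B : ℕ → ℝ := fun M =>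
    |Real.log (stripZ₂ 1 (2 * M + c) y₁ z)| + |Real.log (stripZ₂ 1 (2 * M + c) y₂ z)|
      + (2 * (M : ℝ) + c) * (|Real.log (stripMuY₂ 1 y₁ z)| + |Real.log (stripMuY₂ 1 y₂ z)|)
      + (|Real.log a₁| + |Real.log a₂|) with hB
  set ε : ℕ → ℝ := fun M => if M < max M₁ 1 then B M else 2 * δ M with hε
  refine ⟨ε, ?_, ?_⟩
  · -- `M ε_M → 0`: eventually `ε_M = 2δ_M`
    refine hMδlim.congr' ?_
    filter_upwards [eventually_ge_atTop (max M₁ 1)] with M hM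
    simp only [hε, if_neg (not_lt.2 hM)]
  · intro M y hy
    have hy0 : 0 < y := lt_of_lt_of_le hy₁ hy.1
    have hμ := stripMuY₂_pos 1 hy0 hz
    have hC := stripZ₂_pos 1 (2 * M + c) hy0 hz
    obtain ⟨hA1, hA2⟩ := hA y hy
    have hAy : 0 < A y := lt_of_lt_of_le ha₁ hA1
    by_cases hsmall : M < max M₁ 1
    · -- crude bound
      simp only [hε, if_pos hsmall, hB]
      have h1 : |Real.log (stripZ₂ 1 (2 * M + c) y z)|
          ≤ |Real.log (stripZ₂ 1 (2 * M + c) y₁ z)| + |Real.log (stripZ₂ 1 (2 * M + c) y₂ z)| :=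
        abs_le_abs_add_abs_of_mem
          (Real.log_le_log (stripZ₂_pos 1 _ hy₁ hz) (stripZ₂_mono_left 1 _ hy₁.le hy.1 hz.le))
          (Real.log_le_log hC (stripZ₂_mono_left 1 _ hy0.le hy.2 hz.le))
      have h2 : |Real.log (stripMuY₂ 1 y z)| ≤ |Real.log (stripMuY₂ 1 y₁ z)| + |Real.log (stripMuY₂ 1 y₂ z)| :=
        abs_le_abs_add_abs_of_mem
          (Real.log_le_log (stripMuY₂_pos 1 hy₁ hz) (stripMuY₂_mono_left 1 hy₁ hy.1 hz))
          (Real.log_le_log hμ (stripMuY₂_mono_left 1 hy0 hy.2 hz))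
      have h3 : |Real.log (A y)| ≤ |Real.log a₁| + |Real.log a₂| :=
        abs_le_abs_add_abs_of_mem (Real.log_le_log ha₁ hA1) (Real.log_le_log hAy hA2)
      have hN0 : (0 : ℝ) ≤ 2 * (M : ℝ) + c := by positivity
      calc |Real.log (stripZ₂ 1 (2 * M + c) y z) - (2 * M + c) * Real.log (stripMuY₂ 1 y z) - Real.log (A y)|
          ≤ |Real.log (stripZ₂ 1 (2 * M + c) y z)| + |(2 * (M : ℝ) + c) * Real.log (stripMuY₂ 1 y z)| + |Real.log (A y)| := by
            have := abs_sub (Real.log (stripZ₂ 1 (2 * M + c) y z) - (2 * M + c) * Real.log (stripMuY₂ 1 y z)) (Real.log (A y))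
            have := abs_sub (Real.log (stripZ₂ 1 (2 * M + c) y z)) ((2 * (M : ℝ) + c) * Real.log (stripMuY₂ 1 y z))
            linarith
        _ ≤ _ := by
            rw [abs_mul, abs_of_nonneg hN0]
            have := mul_le_mul_of_nonneg_left h2 hN0
            linarith
    · -- geometric bound through the relative error
      have hM' : max M₁ 1 ≤ M := not_lt.1 hsmall
      have hM1 : 1 ≤ M := le_trans (le_max_right _ _) hM'
      have hMM : M₁ ≤ M := le_trans (le_max_left _ _) hM'
      simp only [hε, if_neg hsmall]
      have hb := hbound y hy c hc (A y) (hlim y hy) M hM1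
      set N := 2 * M + c with hN
      have hμN : 0 < stripMuY₂ 1 y z ^ N := pow_pos hμ N
      have hden : 0 < A y * stripMuY₂ 1 y z ^ N := mul_pos hAy hμN
      -- relative error
      have hrel : |stripZ₂ 1 N y z / (A y * stripMuY₂ 1 y z ^ N) - 1| ≤ δ M := by
        have e : stripZ₂ 1 N y z / (A y * stripMuY₂ 1 y z ^ N) - 1
            = (stripZ₂ 1 N y z - A y * stripMuY₂ 1 y z ^ N) / (A y * stripMuY₂ 1 y z ^ N) := by
          field_simp
        rw [e, abs_div, abs_of_pos hden, div_le_iff₀ hden]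
        calc |stripZ₂ 1 N y z - A y * stripMuY₂ 1 y z ^ N| ≤ K * ((M : ℝ) + 1) * Θ ^ M * stripMuY₂ 1 y z ^ N := hb
          _ = (K * ((M : ℝ) + 1) * Θ ^ M / a₁) * (a₁ * stripMuY₂ 1 y z ^ N) := by field_simp
          _ ≤ δ M * (A y * stripMuY₂ 1 y z ^ N) := by
              rw [hδ]
              exact mul_le_mul_of_nonneg_left (mul_le_mul_of_nonneg_right hA1 hμN.le) (hδ0 M)
      have hlog := abs_log_le_two_mul_of_abs_sub_one_le (hM₁ M hMM) hrel
      have e : Real.log (stripZ₂ 1 N y z / (A y * stripMuY₂ 1 y z ^ N))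
          = Real.log (stripZ₂ 1 N y z) - (2 * M + c) * Real.log (stripMuY₂ 1 y z) - Real.log (A y) := by
        rw [Real.log_div hC.ne' hden.ne', Real.log_mul hAy.ne' hμN.ne', Real.log_pow, hN]
        push_cast
        ring
      rw [e] at hlog
      exact hlog

end WidthOneYZ

end Literature.Probability.RandomPlanarGeometry.SAW.HexBW
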